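import Literature.MathematicalPhysics.QuantumManyBody.BoseGasSubcellCondensation
import Literature.MathematicalPhysics.QuantumManyBody.BoseGasDiluteEnergyFloor
import Literature.MathematicalPhysics.QuantumManyBody.PeriodicBoseGasUpperBoundProofs
import Literature.MathematicalPhysics.QuantumManyBody.EnergyLocalizationProofs
import Literature.MathematicalPhysics.QuantumManyBody.LiebYngvasonTheorem
import Mathlib.Analysis.SpecialFunctions.Pow.Continuity
import HarnessLib

/-!
# Local condensation of Dirichlet near-minimisers at mesoscopic scales in the dilute limit

Topic `Literature/MathematicalPhysics/QuantumManyBody`, namespace `…BoseGas`; companion of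
`BoseGasSubcellCondensation.lean` (support of the crux `BECTangentRigidity.TangentTransfer`,
stmt-AtomisticToContinuum-13033, of the summit `AtomisticToContinuum/BoseEinsteinCondensation`).
That file proves the deterministic floor inequality `seven_eighths_le_sum_occupation`
(LSSY's mechanism (5.15)–(5.17) run cell by cell on a big Dirichlet box).  This file supplies its
inputs in the dilute thermodynamic limit `L = (N/ρ)^{1/3}`, `ρ → 0`, at the mesoscopic scales
`s ∈ [M/√ρ, 2M/√ρ]` (a fixed multiple `M√(8πa)` of the healing length), and draws the conclusion:

* `occupation_bookkeeping` — the convexity bookkeeping of the cell method [LSSY2005, (2.55)–(2.58)]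
  with a crowding penalty: `(1-θ)(4πa/s³)N²/K + κ·N^bad ≤ ∑_c lb(n_c) + B` for every distribution of
  the particles over the cells;
* elementary bounds on the cell parameters (`Y(m) = (4π/3)(m/s³)a³`, the low-cell threshold, the
  excluded volume of the same-cell balls of radius `R(m) = aY(m)^{-5/17}`), the translation from the
  cell side `s` to the density `ρ` at the mesoscopic scale, the budget `floorBudget_le`, and the
  smallness of all side conditions for small `ρ` (`floorParams_eventually`);
* `floor_of_scatteringLength_zero` — zero scattering length: the sharp cell gap `key_inequality`
  and `E₀^D(N, L_N) = o(N)` (from the Dyson–LSSY upper bound with `a = 0`);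
* `floor_of_scatteringLength_pos` — positive scattering length: for every `M > 0` and all small
  `ρ`, eventually in `N`, every `1`-near-minimiser of the Dirichlet energy has
  `∑_q ⟨u_q, γ_Ψ u_q⟩ ≥ 7N/8` over the sub-cells of side `L/2^k ∈ [M/√ρ, 2M/√ρ)` — assembled from
  `seven_eighths_le_sum_occupation` with the localized Lieb–Yngvason bound `locLowerBound_neumann`
  (LSSY Lemma 5.2 in each good cell), `LSSY2005_lowerBound_neumann_holds` plus superadditivity in
  the crowded cells, `LSSY2005_lemma41_holds`, and the Dyson upper bound
  `eventually_groundStateEnergy_le_dyson`.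

No definitions; all constants are explicit or existentially quantified.  Hard cores are allowed
(`IsRepulsiveFiniteRange`, scattering length `≤` range).

## References

* [LSSY2005] E. H. Lieb, R. Seiringer, J. P. Solovej, J. Yngvason, *The Mathematics of the Bose
  Gas and its Condensation*, Oberwolfach Seminars 34, Birkhäuser 2005 (arXiv:cond-mat/0610117):
  Thm. 2.2 (2.14), Thm. 2.4 (2.35) and (2.52)–(2.58), Lemma 4.1, Lemma 5.2, Thm. 5.1 (5.15)–(5.17).
* [LiebSeiringer2002] E. H. Lieb, R. Seiringer, *Proof of Bose–Einstein condensation for dilute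
  trapped gases*, Phys. Rev. Lett. 88 (2002) 170409.
-/

noncomputable section

open MeasureTheory Filter Set Metric
open scoped ENNReal NNReal Topology BigOperators

namespace Literature.MathematicalPhysics.QuantumManyBody.BoseGas

/-! ### Occupation bookkeeping over the cells (LSSY (2.55)–(2.58) with a crowding penalty) -/

/-- **Occupation bookkeeping.**  Distribute `Nt` particles over `Kc` cells, `n_c` in cell `c`.
Suppose a real lower bound `lb` of the cell energies satisfies `lb(m) ≥ (1-θ)(4πa/s³)m²` on `good`
occupation numbers, `lb(m) ≥ 0` and `m < lam` on the other ("low") ones with `m ≤ mth`, and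
`lb(m) ≥ κ_h m` on those with `m > mth` ("high").  If `κ + (1-θ)(8πa/s³)(Nt/Kc) ≤ κ_h` then
`(1-θ)(4πa/s³)Nt²/Kc + κ · #{particles in cells that are not good} ≤ ∑_c lb(n_c) + Kc·lam·((1-θ)(8πa/s³)(Nt/Kc) + κ)`
(convexity `∑_good n_c² ≥ N_good²/Kc`, `N_good² ≥ Nt² - 2Nt(N_low + N_high)`, `N_low ≤ Kc·lam`).
Stated in `ℝ≥0∞` as consumed by `seven_eighths_le_sum_occupation`. [folklore] -/
theorem occupation_bookkeeping {Kc Nt mth : ℕ} (good : ℕ → Prop) [DecidablePred good]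
    (lb : ℕ → ℝ) {lam θ a s κh κ : ℝ} (hs : 0 < s) (ha : 0 ≤ a) (hθ : θ ≤ 1) (hlam : 0 ≤ lam)
    (hκ0 : 0 ≤ κ)
    (hgood : ∀ m, good m → (1 - θ) * (4 * Real.pi * a / s ^ 3) * (m : ℝ) ^ 2 ≤ lb m)
    (hlow : ∀ m, ¬ good m → (m : ℝ) ≤ mth → 0 ≤ lb m ∧ (m : ℝ) ≤ lam)
    (hhigh : ∀ m, ¬ good m → (mth : ℝ) < m → κh * m ≤ lb m)
    (hκ : κ + (1 - θ) * (8 * Real.pi * a / s ^ 3) * ((Nt : ℝ) / Kc) ≤ κh)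
    (nv : Fin Kc → ℕ) (hsum : ∑ c, nv c = Nt) :
    ENNReal.ofReal ((1 - θ) * (4 * Real.pi * a / s ^ 3) * (Nt : ℝ) ^ 2 / Kc) +
        ENNReal.ofReal κ * ∑ c, (if good (nv c) then 0 else (nv c : ℝ≥0∞)) ≤
      (∑ c, ENNReal.ofReal (lb (nv c))) +
        ENNReal.ofReal ((Kc : ℝ) * lam * ((1 - θ) * (8 * Real.pi * a / s ^ 3) * ((Nt : ℝ) / Kc) + κ)) := by
  -- trivial when there are no cells
  rcases Nat.eq_zero_or_pos Kc with hK0 | hKpos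
  · subst hK0
    simp
  have hKr : (0 : ℝ) < Kc := Nat.cast_pos.2 hKpos
  set q : ℝ := (1 - θ) * (4 * Real.pi * a / s ^ 3) with hq
  have hq0 : 0 ≤ q := by rw [hq]; exact mul_nonneg (by linarith) (by positivity)
  set b₀ : ℝ := (1 - θ) * (8 * Real.pi * a / s ^ 3) * ((Nt : ℝ) / Kc) with hb₀
  have hb₀q : b₀ = 2 * q * Nt / Kc := by rw [hb₀, hq]; ring
  -- the three classes of cells
  set G : Finset (Fin Kc) := Finset.univ.filter fun c => good (nv c) with hG
  set Lo : Finset (Fin Kc) := Finset.univ.filter fun c => ¬ good (nv c) ∧ (nv c : ℝ) ≤ mth with hLo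
  set Hi : Finset (Fin Kc) := Finset.univ.filter fun c => ¬ good (nv c) ∧ (mth : ℝ) < nv c with hHi
  set NG : ℝ := ∑ c ∈ G, (nv c : ℝ) with hNG
  set NL : ℝ := ∑ c ∈ Lo, (nv c : ℝ) with hNL
  set NH : ℝ := ∑ c ∈ Hi, (nv c : ℝ) with hNH
  have hNG0 : 0 ≤ NG := Finset.sum_nonneg fun _ _ => Nat.cast_nonneg _
  have hNL0 : 0 ≤ NL := Finset.sum_nonneg fun _ _ => Nat.cast_nonneg _
  have hNH0 : 0 ≤ NH := Finset.sum_nonneg fun _ _ => Nat.cast_nonneg _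
  -- partition of the particle number
  have hsplit_fun : ∀ f : Fin Kc → ℝ, ∑ c, f c = (∑ c ∈ G, f c) + ((∑ c ∈ Lo, f c) + ∑ c ∈ Hi, f c) := by
    intro f
    rw [← Finset.sum_filter_add_sum_filter_not Finset.univ (fun c => good (nv c))]
    congr 1
    rw [← Finset.sum_filter_add_sum_filter_not (Finset.univ.filter fun c => ¬ good (nv c))
      (fun c => (nv c : ℝ) ≤ mth), Finset.filter_filter, Finset.filter_filter]
    congr 2
    ext c; simp [hHi, not_le]
  have hNt : (Nt : ℝ) = NG + (NL + NH) := by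
    have := hsplit_fun fun c => (nv c : ℝ)
    rw [← hsum]; push_cast; exact this
  have hbad_sum : (∑ c, (if good (nv c) then (0 : ℝ) else (nv c : ℝ))) = NL + NH := by
    rw [hsplit_fun]
    have h1 : ∑ c ∈ G, (if good (nv c) then (0 : ℝ) else (nv c : ℝ)) = 0 :=
      Finset.sum_eq_zero fun c hc => by simp [(Finset.mem_filter.1 hc).2]
    have h2 : ∑ c ∈ Lo, (if good (nv c) then (0 : ℝ) else (nv c : ℝ)) = NL :=
      Finset.sum_congr rfl fun c hc => by simp [(Finset.mem_filter.1 hc).2.1]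
    have h3 : ∑ c ∈ Hi, (if good (nv c) then (0 : ℝ) else (nv c : ℝ)) = NH :=
      Finset.sum_congr rfl fun c hc => by simp [(Finset.mem_filter.1 hc).2.1]
    rw [h1, h2, h3, zero_add]
  -- the three lower bounds
  have hGsum : q * NG ^ 2 / Kc ≤ ∑ c ∈ G, lb (nv c) := by
    have hcs : NG ^ 2 ≤ (G.card : ℝ) * ∑ c ∈ G, (nv c : ℝ) ^ 2 := sq_sum_le_card_mul_sum_sq
    have hcard : (G.card : ℝ) ≤ Kc := by
      exact_mod_cast (Finset.card_filter_le _ _).trans (by simp)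
    calc q * NG ^ 2 / Kc ≤ q * ((Kc : ℝ) * ∑ c ∈ G, (nv c : ℝ) ^ 2) / Kc := by
          gcongr
          exact hcs.trans (mul_le_mul_of_nonneg_right hcard
            (Finset.sum_nonneg fun _ _ => by positivity))
      _ = ∑ c ∈ G, q * (nv c : ℝ) ^ 2 := by
          rw [mul_div_assoc, mul_div_cancel_left₀ _ hKr.ne', Finset.mul_sum]
      _ ≤ ∑ c ∈ G, lb (nv c) := Finset.sum_le_sum fun c hc => hgood _ (Finset.mem_filter.1 hc).2
  have hLsum : 0 ≤ ∑ c ∈ Lo, lb (nv c) := Finset.sum_nonneg fun c hc =>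
    (hlow _ (Finset.mem_filter.1 hc).2.1 (Finset.mem_filter.1 hc).2.2).1
  have hHsum : κh * NH ≤ ∑ c ∈ Hi, lb (nv c) := by
    rw [hNH, Finset.mul_sum]
    exact Finset.sum_le_sum fun c hc => hhigh _ (Finset.mem_filter.1 hc).2.1 (Finset.mem_filter.1 hc).2.2
  have hNL_le : NL ≤ (Kc : ℝ) * lam := by
    calc NL ≤ ∑ _c ∈ Lo, lam := Finset.sum_le_sum fun c hc =>
          (hlow _ (Finset.mem_filter.1 hc).2.1 (Finset.mem_filter.1 hc).2.2).2
      _ = (Lo.card : ℝ) * lam := by rw [Finset.sum_const, nsmul_eq_mul]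
      _ ≤ (Kc : ℝ) * lam := by
          gcongr
          exact_mod_cast (Finset.card_filter_le _ _).trans (by simp)
  -- nonnegativity of all `lb` values
  have hb0 : 0 ≤ b₀ := by
    rw [hb₀]; exact mul_nonneg (mul_nonneg (by linarith) (by positivity)) (by positivity)
  have hκh : 0 ≤ κh := le_trans (add_nonneg hκ0 hb0) hκ
  have hlb0 : ∀ c, 0 ≤ lb (nv c) := by
    intro c
    by_cases hg : good (nv c)
    · exact le_trans (by positivity) (hgood _ hg)
    · rcases le_or_gt (nv c : ℝ) mth with h | h
      · exact (hlow _ hg h).1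
      · exact le_trans (by positivity) (hhigh _ hg h)
  -- the real inequality
  have hreal : q * (Nt : ℝ) ^ 2 / Kc + κ * (NL + NH) ≤
      (∑ c, lb (nv c)) + (Kc : ℝ) * lam * (b₀ + κ) := by
    have hsq : (Nt : ℝ) ^ 2 - 2 * Nt * (NL + NH) ≤ NG ^ 2 := by
      rw [hNt]; nlinarith
    have h1 : q * (Nt : ℝ) ^ 2 / Kc - b₀ * (NL + NH) ≤ q * NG ^ 2 / Kc := by
      rw [hb₀q]
      have : q * ((Nt : ℝ) ^ 2 - 2 * Nt * (NL + NH)) / Kc ≤ q * NG ^ 2 / Kc := by gcongr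
      refine le_trans (le_of_eq ?_) this
      field_simp
    have hκ' : κ ≤ κh - b₀ := by linarith
    have hsumlb : (∑ c, lb (nv c)) = (∑ c ∈ G, lb (nv c)) + ((∑ c ∈ Lo, lb (nv c)) + ∑ c ∈ Hi, lb (nv c)) :=
      hsplit_fun _
    nlinarith [mul_le_mul_of_nonneg_right hNL_le (add_nonneg hb0 hκ0), mul_nonneg hb0 hNH0,
      mul_le_mul_of_nonneg_right hκ' hNH0]
  -- conversion to `ℝ≥0∞`
  have hA0 : 0 ≤ q * (Nt : ℝ) ^ 2 / Kc := by positivity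
  have hbadE : (∑ c, (if good (nv c) then (0 : ℝ≥0∞) else (nv c : ℝ≥0∞))) = ENNReal.ofReal (NL + NH) := by
    rw [← hbad_sum, ENNReal.ofReal_sum_of_nonneg (fun c _ => by split_ifs <;> positivity)]
    refine Finset.sum_congr rfl fun c _ => ?_
    split_ifs
    · simp
    · rw [ENNReal.ofReal_natCast]
  have hlbE : (∑ c, ENNReal.ofReal (lb (nv c))) = ENNReal.ofReal (∑ c, lb (nv c)) :=
    (ENNReal.ofReal_sum_of_nonneg fun c _ => hlb0 c).symm
  rw [hbadE, hlbE, ← ENNReal.ofReal_mul hκ0, ← ENNReal.ofReal_add hA0 (by positivity),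
    ← ENNReal.ofReal_add (Finset.sum_nonneg fun c _ => hlb0 c) (by positivity)]
  exact ENNReal.ofReal_le_ofReal (by simpa [hq, hb₀] using hreal)


/-! ### Elementary bookkeeping of the cell parameters -/

/-- Integer division loses at most a factor two above the divisor: `m/(2p) ≤ ⌊m/p⌋` for
`m > p ≥ 1`. [folklore] -/
theorem div_two_mul_le_nat_div {m p : ℕ} (hp : 0 < p) (hmp : p < m) :
    (m : ℝ) / (2 * p) ≤ ((m / p : ℕ) : ℝ) := by
  have hq1 : 1 ≤ m / p := (Nat.one_le_div_iff hp).2 hmp.le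
  have hdm := Nat.div_add_mod m p
  have hmod : m % p < p := Nat.mod_lt _ hp
  have hpr : (0 : ℝ) < p := Nat.cast_pos.2 hp
  rw [div_le_iff₀ (by positivity)]
  have h1 : (m : ℝ) = p * ((m / p : ℕ) : ℝ) + ((m % p : ℕ) : ℝ) := by exact_mod_cast hdm.symm
  have h2 : ((m % p : ℕ) : ℝ) ≤ p := by exact_mod_cast hmod.le
  have h3 : (1 : ℝ) ≤ ((m / p : ℕ) : ℝ) := by exact_mod_cast hq1
  nlinarith

/-- The density parameter of a cell of side `s` holding `m` particles, `Y(m) = (4π/3)(m/s³)a³`, is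
`κ₀ m` with `κ₀ = 4πa³/(3s³)`. [folklore] -/
theorem cellY_eq_mul (m : ℕ) (a s : ℝ) :
    4 * Real.pi * ((m : ℝ) / s ^ 3) * a ^ 3 / 3 = (4 * Real.pi * a ^ 3 / (3 * s ^ 3)) * m := by
  ring

/-- **Cells failing `Y(m)^{-1/17} ≤ m` hold few particles**: if `¬ (Y(m)^{-1/17} ≤ m)` then
`1 ≤ m < (3s³/(4πa³))^{1/18}`. [folklore] -/
theorem lt_lam_of_not_rpow_le {m : ℕ} {a s : ℝ} (ha : 0 < a) (hs : 0 < s)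
    (h : ¬ ((4 * Real.pi * ((m : ℝ) / s ^ 3) * a ^ 3 / 3) ^ (-(1 : ℝ) / 17) ≤ m)) :
    1 ≤ m ∧ (m : ℝ) < (3 * s ^ 3 / (4 * Real.pi * a ^ 3)) ^ ((1 : ℝ) / 18) := by
  set κ₀ : ℝ := 4 * Real.pi * a ^ 3 / (3 * s ^ 3) with hκ₀
  have hκ₀pos : 0 < κ₀ := by rw [hκ₀]; positivity
  rw [cellY_eq_mul] at h
  have hm : 1 ≤ m := by
    by_contra h0
    push Not at h0
    have : m = 0 := by omega
    subst this
    apply h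
    simp [Real.zero_rpow (by norm_num : (-(1 : ℝ) / 17) ≠ 0)]
  refine ⟨hm, ?_⟩
  by_contra hge
  push Not at hge
  apply h
  have hmr : (1 : ℝ) ≤ m := by exact_mod_cast hm
  have hm0 : (0 : ℝ) < m := by linarith
  have hlam0 : 0 ≤ (3 * s ^ 3 / (4 * Real.pi * a ^ 3)) := by positivity
  -- `m^18 ≥ 3s³/(4πa³) = κ₀⁻¹`
  have h18 : κ₀⁻¹ ≤ (m : ℝ) ^ (18 : ℝ) := by
    have := Real.rpow_le_rpow (Real.rpow_nonneg hlam0 _) hge (by norm_num : (0 : ℝ) ≤ 18)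
    rw [← Real.rpow_mul hlam0, show ((1 : ℝ) / 18 * 18) = 1 by norm_num, Real.rpow_one] at this
    rw [hκ₀, inv_div]
    exact this
  -- hence `κ₀ m ≥ m^{-17}` and `(κ₀ m)^{-1/17} ≤ m`
  have hY : (m : ℝ) ^ (-(17 : ℝ)) ≤ κ₀ * m := by
    have h1 : κ₀⁻¹ * (m : ℝ) ^ (-(17 : ℝ)) ≤ (m : ℝ) ^ (18 : ℝ) * (m : ℝ) ^ (-(17 : ℝ)) :=
      mul_le_mul_of_nonneg_right h18 (Real.rpow_nonneg hm0.le _)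
    rw [← Real.rpow_add hm0, show ((18 : ℝ) + -(17 : ℝ)) = 1 by norm_num, Real.rpow_one] at h1
    calc (m : ℝ) ^ (-(17 : ℝ)) = κ₀ * (κ₀⁻¹ * (m : ℝ) ^ (-(17 : ℝ))) := by
          field_simp
      _ ≤ κ₀ * m := mul_le_mul_of_nonneg_left h1 hκ₀pos.le
  have hpos : 0 < (m : ℝ) ^ (-(17 : ℝ)) := Real.rpow_pos_of_pos hm0 _
  calc (κ₀ * m) ^ (-(1 : ℝ) / 17) ≤ ((m : ℝ) ^ (-(17 : ℝ))) ^ (-(1 : ℝ) / 17) :=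
        Real.rpow_le_rpow_of_nonpos hpos hY (by norm_num)
    _ = m := by
        rw [← Real.rpow_mul hm0.le, show (-(17 : ℝ)) * (-(1 : ℝ) / 17) = 1 by norm_num,
          Real.rpow_one]

/-- **The excluded-volume bound** for a good cell: with `R(m) = a Y(m)^{-5/17}` and
`m' + 1 ≤ mth`, `(m' · (4π/3) R(m'+1)³)^{2/3} ≤ ((4π/3) a³ κ₀^{-15/17} mth^{2/17})^{2/3}`,
`κ₀ = 4πa³/(3s³)` (since `m Y(m)^{-15/17} = κ₀^{-15/17} m^{2/17}` increases with `m`). [folklore] -/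
theorem excludedVolume_rpow_le {m' : ℕ} {a s mth : ℝ} (ha : 0 < a) (hs : 0 < s)
    (hm : (m' : ℝ) + 1 ≤ mth) :
    ((m' : ℝ≥0∞) * (ENNReal.ofReal (a * (4 * Real.pi * (((m' + 1 : ℕ) : ℝ) / s ^ 3) * a ^ 3 / 3) ^
        (-(5 : ℝ) / 17)) ^ 3 * ENNReal.ofReal (Real.pi * 4 / 3))) ^ (2 / 3 : ℝ) ≤
      ENNReal.ofReal (((Real.pi * 4 / 3) * a ^ 3 * (4 * Real.pi * a ^ 3 / (3 * s ^ 3)) ^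
        (-(15 : ℝ) / 17) * mth ^ ((2 : ℝ) / 17)) ^ ((2 : ℝ) / 3)) := by
  set κ₀ : ℝ := 4 * Real.pi * a ^ 3 / (3 * s ^ 3) with hκ₀
  have hκ₀pos : 0 < κ₀ := by rw [hκ₀]; positivity
  set Y : ℝ := 4 * Real.pi * (((m' + 1 : ℕ) : ℝ) / s ^ 3) * a ^ 3 / 3 with hY
  have hYeq : Y = κ₀ * ((m' : ℝ) + 1) := by rw [hY, cellY_eq_mul]; push_cast; ring
  have hm1 : (0 : ℝ) < (m' : ℝ) + 1 := by positivity
  have hYpos : 0 < Y := by rw [hYeq]; positivity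
  have hmth : 0 < mth := lt_of_lt_of_le hm1 hm
  -- the left-hand side as `ofReal` of a real number
  have hR0 : 0 ≤ a * Y ^ (-(5 : ℝ) / 17) := by positivity
  have hLHS : (m' : ℝ≥0∞) * (ENNReal.ofReal (a * Y ^ (-(5 : ℝ) / 17)) ^ 3 *
      ENNReal.ofReal (Real.pi * 4 / 3)) =
      ENNReal.ofReal ((m' : ℝ) * ((a * Y ^ (-(5 : ℝ) / 17)) ^ 3 * (Real.pi * 4 / 3))) := by
    rw [← ENNReal.ofReal_natCast, ← ENNReal.ofReal_pow hR0, ← ENNReal.ofReal_mul (by positivity),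
      ← ENNReal.ofReal_mul (Nat.cast_nonneg _)]
  rw [hLHS, ENNReal.ofReal_rpow_of_nonneg (by positivity) (by norm_num)]
  refine ENNReal.ofReal_le_ofReal (Real.rpow_le_rpow (by positivity) ?_ (by norm_num))
  -- the real inequality `m' (aY^{-5/17})³ (4π/3) ≤ (4π/3) a³ κ₀^{-15/17} mth^{2/17}`
  have h3 : (a * Y ^ (-(5 : ℝ) / 17)) ^ 3 = a ^ 3 * Y ^ (-(15 : ℝ) / 17) := by
    rw [mul_pow, ← Real.rpow_natCast (Y ^ (-(5 : ℝ) / 17)) 3, ← Real.rpow_mul hYpos.le]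
    norm_num
  have hYr : Y ^ (-(15 : ℝ) / 17) = κ₀ ^ (-(15 : ℝ) / 17) * ((m' : ℝ) + 1) ^ (-(15 : ℝ) / 17) := by
    rw [hYeq, Real.mul_rpow hκ₀pos.le hm1.le]
  have hmm : (m' : ℝ) * ((m' : ℝ) + 1) ^ (-(15 : ℝ) / 17) ≤ mth ^ ((2 : ℝ) / 17) := by
    calc (m' : ℝ) * ((m' : ℝ) + 1) ^ (-(15 : ℝ) / 17)
        ≤ ((m' : ℝ) + 1) * ((m' : ℝ) + 1) ^ (-(15 : ℝ) / 17) :=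
          mul_le_mul_of_nonneg_right (by linarith) (Real.rpow_nonneg hm1.le _)
      _ = ((m' : ℝ) + 1) ^ ((2 : ℝ) / 17) := by
          conv_lhs => rw [show ((m' : ℝ) + 1) = ((m' : ℝ) + 1) ^ (1 : ℝ) from (Real.rpow_one _).symm]
          rw [← Real.rpow_mul hm1.le, ← Real.rpow_add hm1]
          norm_num
      _ ≤ mth ^ ((2 : ℝ) / 17) := Real.rpow_le_rpow hm1.le hm (by norm_num)
  calc (m' : ℝ) * ((a * Y ^ (-(5 : ℝ) / 17)) ^ 3 * (Real.pi * 4 / 3))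
      = (Real.pi * 4 / 3) * a ^ 3 * κ₀ ^ (-(15 : ℝ) / 17) *
          ((m' : ℝ) * ((m' : ℝ) + 1) ^ (-(15 : ℝ) / 17)) := by rw [h3, hYr]; ring
    _ ≤ (Real.pi * 4 / 3) * a ^ 3 * κ₀ ^ (-(15 : ℝ) / 17) * mth ^ ((2 : ℝ) / 17) :=
        mul_le_mul_of_nonneg_left hmm (by positivity)


/-! ### Scale bounds at the mesoscopic scale `s ∈ [M/√ρ, 2M/√ρ]` -/

section Scale

variable {M ρ s : ℝ}

/-- `s² ≤ 4M²/ρ`. [folklore] -/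
theorem sq_le_of_scale (hρ : 0 < ρ) (hsu : s ≤ 2 * M / Real.sqrt ρ)
    (hs : 0 < s) : s ^ 2 ≤ 4 * M ^ 2 / ρ := by
  have hsq : Real.sqrt ρ ^ 2 = ρ := Real.sq_sqrt hρ.le
  have hsr : 0 < Real.sqrt ρ := Real.sqrt_pos.2 hρ
  have h1 : s * Real.sqrt ρ ≤ 2 * M := by rwa [le_div_iff₀ hsr] at hsu
  have h2 : (s * Real.sqrt ρ) ^ 2 ≤ (2 * M) ^ 2 := pow_le_pow_left₀ (by positivity) h1 2
  rw [le_div_iff₀ hρ]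
  nlinarith

/-- `1/s ≤ √ρ/M`. [folklore] -/
theorem inv_le_of_scale (hM : 0 < M) (hρ : 0 < ρ) (hsl : M / Real.sqrt ρ ≤ s) :
    1 / s ≤ Real.sqrt ρ / M := by
  have hsr : 0 < Real.sqrt ρ := Real.sqrt_pos.2 hρ
  have hs : 0 < s := lt_of_lt_of_le (by positivity) hsl
  rw [div_le_div_iff₀ hs hM, one_mul]
  rw [div_le_iff₀ hsr] at hsl
  linarith

/-- `1/s³ ≤ ρ√ρ/M³`. [folklore] -/
theorem inv_cube_le_of_scale (hM : 0 < M) (hρ : 0 < ρ) (hsl : M / Real.sqrt ρ ≤ s) :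
    1 / s ^ 3 ≤ ρ * Real.sqrt ρ / M ^ 3 := by
  have hsr : 0 < Real.sqrt ρ := Real.sqrt_pos.2 hρ
  have hs : 0 < s := lt_of_lt_of_le (by positivity) hsl
  have h := inv_le_of_scale hM hρ hsl
  have h3 : (1 / s) ^ 3 ≤ (Real.sqrt ρ / M) ^ 3 := pow_le_pow_left₀ (by positivity) h 3
  have hsq : Real.sqrt ρ ^ 3 = ρ * Real.sqrt ρ := by
    rw [pow_succ, Real.sq_sqrt hρ.le]
  calc 1 / s ^ 3 = (1 / s) ^ 3 := by rw [div_pow, one_pow]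
    _ ≤ (Real.sqrt ρ / M) ^ 3 := h3
    _ = ρ * Real.sqrt ρ / M ^ 3 := by rw [div_pow, hsq]

/-- `ρ√ρ/(8M³) ≤ 1/s³` (from `s ≤ 2M/√ρ`). [folklore] -/
theorem le_inv_cube_of_scale (hM : 0 < M) (hρ : 0 < ρ) (hsu : s ≤ 2 * M / Real.sqrt ρ)
    (hs : 0 < s) : ρ * Real.sqrt ρ / (8 * M ^ 3) ≤ 1 / s ^ 3 := by
  have hsr : 0 < Real.sqrt ρ := Real.sqrt_pos.2 hρ
  have h1 : s * Real.sqrt ρ ≤ 2 * M := by rwa [le_div_iff₀ hsr] at hsu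
  have h3 : (s * Real.sqrt ρ) ^ 3 ≤ (2 * M) ^ 3 := pow_le_pow_left₀ (by positivity) h1 3
  have hsq : Real.sqrt ρ ^ 3 = ρ * Real.sqrt ρ := by rw [pow_succ, Real.sq_sqrt hρ.le]
  rw [div_le_div_iff₀ (by positivity) (by positivity), one_mul]
  calc ρ * Real.sqrt ρ * s ^ 3 = (s * Real.sqrt ρ) ^ 3 := by rw [mul_pow, hsq]; ring
    _ ≤ (2 * M) ^ 3 := h3
    _ = 8 * M ^ 3 := by ring

end Scale

/-! ### The budget -/

/-- **The budget of the floor inequality at the mesoscopic scale.**  With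
`U = 4πρa(1 + C_u(ρa³)^{1/3})N + 1`, `A = (1-θ)(4πa/s³)N²/K`, `B = K·lam·((1-θ)(8πa/s³)(N/K) + 1/(2Cs²))`,
`N/K = ρs³` and `M/√ρ ≤ s ≤ 2M/√ρ`, the quantity `2Cs²(U + B - A) + CwU` is at most `N/8` as
soon as the per-particle terms are `≤ 1/16` and `N ≥ 16(8CM²/ρ + C w̄)`. [folklore] -/
theorem floorBudget_le {a C Cu M ρ s lam lambar w wbar θ θbar N K : ℝ} (hM : 0 < M) (ha : 0 < a)
    (hC : 0 < C) (hCu : 0 ≤ Cu) (hρ : 0 < ρ) (hsl : M / Real.sqrt ρ ≤ s)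
    (hsu : s ≤ 2 * M / Real.sqrt ρ) (hθ0 : 0 ≤ θ) (hθ : θ ≤ θbar)
    (hlam0 : 0 ≤ lam) (hlam : lam ≤ lambar) (hw0 : 0 ≤ w) (hw : w ≤ wbar) (hN0 : 0 ≤ N)
    (hK : 0 < K) (hKN : N / K = ρ * s ^ 3) (ht1 : Cu * (ρ * a ^ 3) ^ ((1 : ℝ) / 3) ≤ 1)
    (hpar : 32 * Real.pi * C * M ^ 2 * a * (Cu * (ρ * a ^ 3) ^ ((1 : ℝ) / 3) + θbar) +
      16 * Real.pi * C * a * lambar * Real.sqrt ρ / M + lambar * Real.sqrt ρ / M ^ 3 +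
        8 * Real.pi * C * a * ρ * wbar ≤ 1 / 16)
    (hN : 16 * (8 * C * M ^ 2 / ρ + C * wbar) ≤ N) :
    2 * C * s ^ 2 * ((4 * Real.pi * ρ * a * (1 + Cu * (ρ * a ^ 3) ^ ((1 : ℝ) / 3)) * N + 1) +
        K * lam * ((1 - θ) * (8 * Real.pi * a / s ^ 3) * (N / K) + 1 / (2 * C * s ^ 2)) -
          (1 - θ) * (4 * Real.pi * a / s ^ 3) * N ^ 2 / K) +
      C * w * (4 * Real.pi * ρ * a * (1 + Cu * (ρ * a ^ 3) ^ ((1 : ℝ) / 3)) * N + 1) ≤ N / 8 := by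
  have hsr : 0 < Real.sqrt ρ := Real.sqrt_pos.2 hρ
  have hs : 0 < s := lt_of_lt_of_le (by positivity) hsl
  set t : ℝ := Cu * (ρ * a ^ 3) ^ ((1 : ℝ) / 3) with ht
  have ht0 : 0 ≤ t := by positivity
  -- `K = N/(ρ s³)` bookkeeping
  have hKeq : K * (ρ * s ^ 3) = N := by
    field_simp at hKN; linarith [hKN]
  have hA : (1 - θ) * (4 * Real.pi * a / s ^ 3) * N ^ 2 / K = (1 - θ) * 4 * Real.pi * a * ρ * N := by
    have h1 : N ^ 2 / K = N * (N / K) := by rw [pow_two, mul_div_assoc]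
    rw [mul_div_assoc, h1, hKN]
    field_simp
  have hB : K * lam * ((1 - θ) * (8 * Real.pi * a / s ^ 3) * (N / K) + 1 / (2 * C * s ^ 2)) =
      N * lam * ((1 - θ) * 8 * Real.pi * a) / s ^ 3 + N * lam / (2 * C * ρ * s ^ 5) := by
    have hKinv : K = N / (ρ * s ^ 3) := by field_simp; linarith [hKeq]
    rw [hKN, hKinv]
    field_simp
  -- the scale bounds
  have hlb : 0 ≤ lambar := hlam0.trans hlam
  have hwbar : 0 ≤ wbar := hw0.trans hw
  have hs2 := sq_le_of_scale hρ hsu hs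
  have hs1 := inv_le_of_scale hM hρ hsl
  have hs3 := inv_cube_le_of_scale hM hρ hsl
  -- term by term
  have hT1 : 2 * C * s ^ 2 * (4 * Real.pi * ρ * a * (1 + t) * N - (1 - θ) * 4 * Real.pi * a * ρ * N) ≤
      N * (32 * Real.pi * C * M ^ 2 * a * (t + θbar)) := by
    have h1 : 4 * Real.pi * ρ * a * (1 + t) * N - (1 - θ) * 4 * Real.pi * a * ρ * N =
        4 * Real.pi * a * N * (t + θ) * ρ := by ring
    rw [h1]
    have h2 : 2 * C * s ^ 2 * (4 * Real.pi * a * N * (t + θ) * ρ) =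
        8 * Real.pi * C * a * N * (t + θ) * (ρ * s ^ 2) := by ring
    rw [h2]
    have hρs : ρ * s ^ 2 ≤ 4 * M ^ 2 := by
      have := mul_le_mul_of_nonneg_left hs2 hρ.le
      rwa [mul_div_cancel₀ _ hρ.ne'] at this
    have h3 : t + θ ≤ t + θbar := by linarith
    have hθb : 0 ≤ t + θbar := by linarith
    calc 8 * Real.pi * C * a * N * (t + θ) * (ρ * s ^ 2)
        ≤ 8 * Real.pi * C * a * N * (t + θbar) * (4 * M ^ 2) := by gcongr
      _ = N * (32 * Real.pi * C * M ^ 2 * a * (t + θbar)) := by ring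
  have hT2 : 2 * C * s ^ 2 * 1 ≤ 8 * C * M ^ 2 / ρ := by
    rw [mul_one]
    calc 2 * C * s ^ 2 ≤ 2 * C * (4 * M ^ 2 / ρ) := by gcongr
      _ = 8 * C * M ^ 2 / ρ := by ring
  have hT3 : 2 * C * s ^ 2 * (N * lam * ((1 - θ) * 8 * Real.pi * a) / s ^ 3) ≤
      N * (16 * Real.pi * C * a * lambar * Real.sqrt ρ / M) := by
    have h1 : 2 * C * s ^ 2 * (N * lam * ((1 - θ) * 8 * Real.pi * a) / s ^ 3) =
        16 * Real.pi * C * a * N * ((1 - θ) * lam) * (1 / s) := by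
      field_simp
      ring
    rw [h1]
    have h2 : (1 - θ) * lam ≤ lambar := by nlinarith
    calc 16 * Real.pi * C * a * N * ((1 - θ) * lam) * (1 / s)
        ≤ 16 * Real.pi * C * a * N * lambar * (Real.sqrt ρ / M) := by
          gcongr
      _ = N * (16 * Real.pi * C * a * lambar * Real.sqrt ρ / M) := by ring
  have hT4 : 2 * C * s ^ 2 * (N * lam / (2 * C * ρ * s ^ 5)) ≤ N * (lambar * Real.sqrt ρ / M ^ 3) := by
    have h1 : 2 * C * s ^ 2 * (N * lam / (2 * C * ρ * s ^ 5)) = N * lam / ρ * (1 / s ^ 3) := by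
      field_simp
    rw [h1]
    calc N * lam / ρ * (1 / s ^ 3) ≤ N * lambar / ρ * (ρ * Real.sqrt ρ / M ^ 3) := by gcongr
      _ = N * (lambar * Real.sqrt ρ / M ^ 3) := by field_simp
  have hT5 : C * w * (4 * Real.pi * ρ * a * (1 + t) * N + 1) ≤
      N * (8 * Real.pi * C * a * ρ * wbar) + C * wbar := by
    have h1 : 1 + t ≤ 2 := by linarith
    calc C * w * (4 * Real.pi * ρ * a * (1 + t) * N + 1)
        ≤ C * wbar * (4 * Real.pi * ρ * a * 2 * N + 1) := by gcongr
      _ = N * (8 * Real.pi * C * a * ρ * wbar) + C * wbar := by ring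
  -- assemble
  have htot : N * (32 * Real.pi * C * M ^ 2 * a * (t + θbar)) + 8 * C * M ^ 2 / ρ +
      N * (16 * Real.pi * C * a * lambar * Real.sqrt ρ / M) + N * (lambar * Real.sqrt ρ / M ^ 3) +
      (N * (8 * Real.pi * C * a * ρ * wbar) + C * wbar) ≤ N / 8 := by
    have h1 : N * (32 * Real.pi * C * M ^ 2 * a * (t + θbar)) +
        N * (16 * Real.pi * C * a * lambar * Real.sqrt ρ / M) + N * (lambar * Real.sqrt ρ / M ^ 3) +
        N * (8 * Real.pi * C * a * ρ * wbar) ≤ N * (1 / 16) := by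
      calc N * (32 * Real.pi * C * M ^ 2 * a * (t + θbar)) +
            N * (16 * Real.pi * C * a * lambar * Real.sqrt ρ / M) + N * (lambar * Real.sqrt ρ / M ^ 3) +
            N * (8 * Real.pi * C * a * ρ * wbar)
          = N * (32 * Real.pi * C * M ^ 2 * a * (t + θbar) +
              16 * Real.pi * C * a * lambar * Real.sqrt ρ / M + lambar * Real.sqrt ρ / M ^ 3 +
              8 * Real.pi * C * a * ρ * wbar) := by ring
        _ ≤ N * (1 / 16) := mul_le_mul_of_nonneg_left hpar hN0
    have h2 : 8 * C * M ^ 2 / ρ + C * wbar ≤ N / 16 := by linarith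
    linarith
  calc _ = 2 * C * s ^ 2 * (4 * Real.pi * ρ * a * (1 + t) * N - (1 - θ) * 4 * Real.pi * a * ρ * N) +
        2 * C * s ^ 2 * 1 + 2 * C * s ^ 2 * (N * lam * ((1 - θ) * 8 * Real.pi * a) / s ^ 3) +
        2 * C * s ^ 2 * (N * lam / (2 * C * ρ * s ^ 5)) +
        C * w * (4 * Real.pi * ρ * a * (1 + t) * N + 1) := by rw [hA, hB]; ring
    _ ≤ _ := by linarith [hT1, hT2, hT3, hT4, hT5, htot]


/-! ### From the cell side `s` to the density `ρ` -/

section CellToDensity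

variable {a M ρ s : ℝ} {mth : ℕ}

/-- The prefactor `κ₀ = 4πa³/(3s³)` of the cell density parameter is at most `4πa³ρ√ρ/(3M³)`
for `s ≥ M/√ρ`. [folklore] -/
theorem kappa0_le (ha : 0 < a) (hM : 0 < M) (hρ : 0 < ρ) (hsl : M / Real.sqrt ρ ≤ s) :
    4 * Real.pi * a ^ 3 / (3 * s ^ 3) ≤ 4 * Real.pi * a ^ 3 * (ρ * Real.sqrt ρ) / (3 * M ^ 3) := by
  have hs : 0 < s := lt_of_lt_of_le (by positivity) hsl
  have h := inv_cube_le_of_scale hM hρ hsl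
  calc 4 * Real.pi * a ^ 3 / (3 * s ^ 3) = 4 * Real.pi * a ^ 3 / 3 * (1 / s ^ 3) := by ring
    _ ≤ 4 * Real.pi * a ^ 3 / 3 * (ρ * Real.sqrt ρ / M ^ 3) := by gcongr
    _ = _ := by ring

/-- … and at least `πa³ρ√ρ/(6M³)` for `s ≤ 2M/√ρ`. [folklore] -/
theorem le_kappa0 (ha : 0 < a) (hM : 0 < M) (hρ : 0 < ρ) (hsu : s ≤ 2 * M / Real.sqrt ρ)
    (hs : 0 < s) :
    Real.pi * a ^ 3 * (ρ * Real.sqrt ρ) / (6 * M ^ 3) ≤ 4 * Real.pi * a ^ 3 / (3 * s ^ 3) := by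
  have h := le_inv_cube_of_scale hM hρ hsu hs
  calc Real.pi * a ^ 3 * (ρ * Real.sqrt ρ) / (6 * M ^ 3)
      = 4 * Real.pi * a ^ 3 / 3 * (ρ * Real.sqrt ρ / (8 * M ^ 3)) := by ring
    _ ≤ 4 * Real.pi * a ^ 3 / 3 * (1 / s ^ 3) := by gcongr
    _ = _ := by ring

/-- The crowding threshold `mth = ⌈ρ⁻¹⌉₊` satisfies `ρ⁻¹ ≤ mth ≤ 2/ρ` for `0 < ρ ≤ 1`. [folklore] -/
theorem ceil_inv_bounds (hρ : 0 < ρ) (hρ1 : ρ ≤ 1) :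
    ρ⁻¹ ≤ (⌈ρ⁻¹⌉₊ : ℝ) ∧ (⌈ρ⁻¹⌉₊ : ℝ) ≤ 2 / ρ ∧ 1 ≤ ⌈ρ⁻¹⌉₊ := by
  have h1 : ρ⁻¹ ≤ (⌈ρ⁻¹⌉₊ : ℝ) := Nat.le_ceil _
  have h2 : (⌈ρ⁻¹⌉₊ : ℝ) < ρ⁻¹ + 1 := Nat.ceil_lt_add_one (by positivity)
  have h3 : (1 : ℝ) ≤ ρ⁻¹ := one_le_inv_iff₀.2 ⟨hρ, hρ1⟩
  refine ⟨h1, ?_, ?_⟩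
  · rw [div_eq_mul_inv]; linarith
  · have : (1 : ℝ) ≤ ⌈ρ⁻¹⌉₊ := h3.trans h1
    exact_mod_cast this

/-- **Upper density bound**: every cell with at most `mth ≤ 2/ρ` particles has
`Y(m) = κ₀ m ≤ 8πa³√ρ/(3M³)`. [folklore] -/
theorem cellY_le_Ymax (ha : 0 < a) (hM : 0 < M) (hρ : 0 < ρ) (hsl : M / Real.sqrt ρ ≤ s)
    {m : ℕ} (hm : (m : ℝ) ≤ mth) (hmth : (mth : ℝ) ≤ 2 / ρ) :
    4 * Real.pi * ((m : ℝ) / s ^ 3) * a ^ 3 / 3 ≤ 8 * Real.pi * a ^ 3 * Real.sqrt ρ / (3 * M ^ 3) := by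
  rw [cellY_eq_mul]
  have hk := kappa0_le ha hM hρ hsl
  have hs : 0 < s := lt_of_lt_of_le (by positivity) hsl
  have hk0 : 0 ≤ 4 * Real.pi * a ^ 3 / (3 * s ^ 3) := by positivity
  calc 4 * Real.pi * a ^ 3 / (3 * s ^ 3) * m ≤ 4 * Real.pi * a ^ 3 / (3 * s ^ 3) * (2 / ρ) :=
        mul_le_mul_of_nonneg_left (hm.trans hmth) hk0
    _ ≤ 4 * Real.pi * a ^ 3 * (ρ * Real.sqrt ρ) / (3 * M ^ 3) * (2 / ρ) :=
        mul_le_mul_of_nonneg_right hk (by positivity)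
    _ = 8 * Real.pi * a ^ 3 * Real.sqrt ρ / (3 * M ^ 3) := by field_simp; ring

/-- **Lower density bound at the threshold**: `Y(mth) ≥ πa³√ρ/(6M³)` for `mth ≥ ρ⁻¹`.
[folklore] -/
theorem Ymin_le_cellY (ha : 0 < a) (hM : 0 < M) (hρ : 0 < ρ) (hsu : s ≤ 2 * M / Real.sqrt ρ)
    (hs : 0 < s) (hmth : ρ⁻¹ ≤ (mth : ℝ)) :
    Real.pi * a ^ 3 * Real.sqrt ρ / (6 * M ^ 3) ≤ 4 * Real.pi * ((mth : ℝ) / s ^ 3) * a ^ 3 / 3 := by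
  rw [cellY_eq_mul]
  have hk := le_kappa0 ha hM hρ hsu hs
  calc Real.pi * a ^ 3 * Real.sqrt ρ / (6 * M ^ 3)
      = Real.pi * a ^ 3 * (ρ * Real.sqrt ρ) / (6 * M ^ 3) * ρ⁻¹ := by field_simp
    _ ≤ 4 * Real.pi * a ^ 3 / (3 * s ^ 3) * mth :=
        mul_le_mul hk hmth (by positivity) (by positivity)

/-- **The low-cell threshold** `lam = (3s³/(4πa³))^{1/18}` is at most
`(6M³/(πa³ρ√ρ))^{1/18}` for `s ≤ 2M/√ρ`. [folklore] -/
theorem lam_le_lambar (ha : 0 < a) (hM : 0 < M) (hρ : 0 < ρ) (hsu : s ≤ 2 * M / Real.sqrt ρ)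
    (hs : 0 < s) :
    (3 * s ^ 3 / (4 * Real.pi * a ^ 3)) ^ ((1 : ℝ) / 18) ≤
      (6 * M ^ 3 / (Real.pi * a ^ 3 * (ρ * Real.sqrt ρ))) ^ ((1 : ℝ) / 18) := by
  refine Real.rpow_le_rpow (by positivity) ?_ (by norm_num)
  have hk := le_kappa0 ha hM hρ hsu hs
  -- invert `πa³ρ√ρ/(6M³) ≤ 4πa³/(3s³)`
  have h1 : (4 * Real.pi * a ^ 3 / (3 * s ^ 3))⁻¹ ≤ (Real.pi * a ^ 3 * (ρ * Real.sqrt ρ) / (6 * M ^ 3))⁻¹ :=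
    inv_anti₀ (by positivity) hk
  convert h1 using 1 <;> field_simp

/-- **The excluded-volume constant** `w = ((4π/3)a³κ₀^{-15/17} mth^{2/17})^{2/3}` is at most
`((4π/3) a³ (πa³ρ√ρ/(6M³))^{-15/17} (2/ρ)^{2/17})^{2/3}` for `s ≤ 2M/√ρ`, `mth ≤ 2/ρ`. [folklore] -/
theorem w_le_wbar (ha : 0 < a) (hM : 0 < M) (hρ : 0 < ρ) (hsu : s ≤ 2 * M / Real.sqrt ρ)
    (hs : 0 < s) (hmth0 : 0 < (mth : ℝ)) (hmth : (mth : ℝ) ≤ 2 / ρ) :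
    ((Real.pi * 4 / 3) * a ^ 3 * (4 * Real.pi * a ^ 3 / (3 * s ^ 3)) ^ (-(15 : ℝ) / 17) *
        (mth : ℝ) ^ ((2 : ℝ) / 17)) ^ ((2 : ℝ) / 3) ≤
      ((Real.pi * 4 / 3) * a ^ 3 * (Real.pi * a ^ 3 * (ρ * Real.sqrt ρ) / (6 * M ^ 3)) ^ (-(15 : ℝ) / 17) *
        (2 / ρ) ^ ((2 : ℝ) / 17)) ^ ((2 : ℝ) / 3) := by
  have hk := le_kappa0 ha hM hρ hsu hs
  have hkmin : 0 < Real.pi * a ^ 3 * (ρ * Real.sqrt ρ) / (6 * M ^ 3) := by positivity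
  refine Real.rpow_le_rpow (by positivity) ?_ (by norm_num)
  refine mul_le_mul ?_ (Real.rpow_le_rpow hmth0.le hmth (by norm_num)) (by positivity) (by positivity)
  exact mul_le_mul_of_nonneg_left (Real.rpow_le_rpow_of_nonpos hkmin hk (by norm_num)) (by positivity)

/-- **The penalty condition** `1/(2Cs²) + (1-θ)(8πa/s³)(ρs³) ≤ πa·mth/s³` follows from
`√ρ (1/(2CM²) + 8πa) ≤ πa/(8M³)`. [folklore] -/
theorem kappa_condition {C θ : ℝ} (ha : 0 < a) (hM : 0 < M) (hρ : 0 < ρ) (hC : 0 < C)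
    (hsl : M / Real.sqrt ρ ≤ s) (hsu : s ≤ 2 * M / Real.sqrt ρ) (hθ0 : 0 ≤ θ)
    (hmth : ρ⁻¹ ≤ (mth : ℝ))
    (hpar : Real.sqrt ρ * (1 / (2 * C * M ^ 2) + 8 * Real.pi * a) ≤ Real.pi * a / (8 * M ^ 3)) :
    1 / (2 * C * s ^ 2) + (1 - θ) * (8 * Real.pi * a / s ^ 3) * (ρ * s ^ 3) ≤
      Real.pi * a * mth / s ^ 3 := by
  have hsr : 0 < Real.sqrt ρ := Real.sqrt_pos.2 hρ
  have hs : 0 < s := lt_of_lt_of_le (by positivity) hsl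
  have hs2 : 1 / s ^ 2 ≤ ρ / M ^ 2 := by
    have h := inv_le_of_scale hM hρ hsl
    have h2 : (1 / s) ^ 2 ≤ (Real.sqrt ρ / M) ^ 2 := pow_le_pow_left₀ (by positivity) h 2
    rw [div_pow, one_pow, div_pow, Real.sq_sqrt hρ.le] at h2
    exact h2
  have hs3 := le_inv_cube_of_scale hM hρ hsu hs
  -- left side ≤ ρ/(2CM²) + 8πaρ
  have h1 : 1 / (2 * C * s ^ 2) + (1 - θ) * (8 * Real.pi * a / s ^ 3) * (ρ * s ^ 3) ≤
      ρ / (2 * C * M ^ 2) + 8 * Real.pi * a * ρ := by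
    have e1 : 1 / (2 * C * s ^ 2) = 1 / (2 * C) * (1 / s ^ 2) := by field_simp
    have e2 : (1 - θ) * (8 * Real.pi * a / s ^ 3) * (ρ * s ^ 3) = (1 - θ) * (8 * Real.pi * a * ρ) := by
      field_simp
    rw [e1, e2]
    have h3 : 1 / (2 * C) * (1 / s ^ 2) ≤ 1 / (2 * C) * (ρ / M ^ 2) :=
      mul_le_mul_of_nonneg_left hs2 (by positivity)
    have h4 : (1 - θ) * (8 * Real.pi * a * ρ) ≤ 1 * (8 * Real.pi * a * ρ) :=
      mul_le_mul_of_nonneg_right (by linarith) (by positivity)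
    calc _ ≤ 1 / (2 * C) * (ρ / M ^ 2) + 1 * (8 * Real.pi * a * ρ) := add_le_add h3 h4
      _ = _ := by field_simp
  -- right side ≥ πa√ρ/(8M³)
  have h2 : Real.pi * a * Real.sqrt ρ / (8 * M ^ 3) ≤ Real.pi * a * mth / s ^ 3 := by
    calc Real.pi * a * Real.sqrt ρ / (8 * M ^ 3) = Real.pi * a * (ρ * Real.sqrt ρ / (8 * M ^ 3)) * ρ⁻¹ := by
          field_simp
      _ ≤ Real.pi * a * (1 / s ^ 3) * mth := mul_le_mul (mul_le_mul_of_nonneg_left hs3 (by positivity))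
          hmth (by positivity) (by positivity)
      _ = Real.pi * a * mth / s ^ 3 := by field_simp
  -- middle: `ρ/(2CM²) + 8πaρ = √ρ · √ρ (1/(2CM²) + 8πa) ≤ √ρ πa/(8M³)`
  have h3 : ρ / (2 * C * M ^ 2) + 8 * Real.pi * a * ρ ≤ Real.pi * a * Real.sqrt ρ / (8 * M ^ 3) := by
    have := mul_le_mul_of_nonneg_left hpar hsr.le
    have hρρ : Real.sqrt ρ * Real.sqrt ρ = ρ := Real.mul_self_sqrt hρ.le
    calc ρ / (2 * C * M ^ 2) + 8 * Real.pi * a * ρ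
        = Real.sqrt ρ * (Real.sqrt ρ * (1 / (2 * C * M ^ 2) + 8 * Real.pi * a)) := by
          rw [← mul_assoc, hρρ]; field_simp
      _ ≤ Real.sqrt ρ * (Real.pi * a / (8 * M ^ 3)) := this
      _ = _ := by field_simp
  linarith

end CellToDensity


/-! ### Smallness of the parameters in the dilute limit -/

section Dilute

/-- `(√ρ)^e → 0` as `ρ → 0⁺`, for `e > 0`. [folklore] -/
theorem tendsto_sqrt_rpow {e : ℝ} (he : 0 < e) :
    Tendsto (fun ρ : ℝ => Real.sqrt ρ ^ e) (𝓝[>] 0) (𝓝 0) := by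
  have h1 : Tendsto Real.sqrt (𝓝 (0 : ℝ)) (𝓝 0) := by
    have := Real.continuous_sqrt.tendsto 0
    rwa [Real.sqrt_zero] at this
  have h2 : Tendsto (fun x : ℝ => x ^ e) (𝓝 0) (𝓝 0) := by
    have := (Real.continuousAt_rpow_const 0 e (Or.inr he.le)).tendsto
    simpa [Real.zero_rpow he.ne'] using this
  exact (h2.comp h1).mono_left nhdsWithin_le_nhds

/-- A function eventually equal on `(0, ∞)` to `c (√ρ)^e`, `e > 0`, tends to `0` as `ρ → 0⁺`.
[folklore] -/
theorem tendsto_zero_of_eq_const_mul_sqrt_rpow {f : ℝ → ℝ} (c : ℝ) {e : ℝ} (he : 0 < e)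
    (hf : ∀ ρ, 0 < ρ → f ρ = c * Real.sqrt ρ ^ e) : Tendsto f (𝓝[>] 0) (𝓝 0) := by
  have h : Tendsto (fun ρ : ℝ => c * Real.sqrt ρ ^ e) (𝓝[>] 0) (𝓝 0) := by
    simpa using (tendsto_sqrt_rpow he).const_mul c
  refine h.congr' ?_
  filter_upwards [self_mem_nhdsWithin] with ρ hρ
  exact (hf ρ hρ).symm

/-- Extracting a threshold from an eventual statement at `0⁺`. [folklore] -/
theorem exists_pos_forall_of_eventually {P : ℝ → Prop} (h : ∀ᶠ ρ in 𝓝[>] (0 : ℝ), P ρ) :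
    ∃ ρ₀ : ℝ, 0 < ρ₀ ∧ ∀ ρ : ℝ, 0 < ρ → ρ < ρ₀ → P ρ := by
  rw [eventually_nhdsWithin_iff, Metric.eventually_nhds_iff] at h
  obtain ⟨ε, hε, hP⟩ := h
  refine ⟨ε, hε, fun ρ hρ hρε => hP ?_ hρ⟩
  rw [Real.dist_eq, sub_zero, abs_of_pos hρ]
  exact hρε

/-- **Smallness of the floor parameters in the dilute limit.**  For fixed positive constants
(scattering length `a`, scale factor `M`, the constants `C₁`, `C₂`, `C₂'`, `C₄`, `C_u` and
thresholds `δ₁`, `δ₂` of the lower / upper bounds and of Lemma 4.1) all the side conditions and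
the per-particle budget of the floor proof hold for every sufficiently small density `ρ`.
[folklore] -/
theorem floorParams_eventually {a M C₁ C₂ C₂' C₄ Cu δ₁ δ₂ : ℝ} (ha : 0 < a) (hM : 0 < M)
    (hδ₁ : 0 < δ₁) (hδ₂ : 0 < δ₂) :
    ∃ ρ₀ : ℝ, 0 < ρ₀ ∧ ∀ ρ : ℝ, 0 < ρ → ρ < ρ₀ →
      ρ ≤ 1 ∧
      8 * Real.pi * a ^ 3 * Real.sqrt ρ / (3 * M ^ 3) < δ₁ ∧
      8 * Real.pi * a ^ 3 * Real.sqrt ρ / (3 * M ^ 3) < δ₂ ∧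
      (8 * Real.pi * a ^ 3 * Real.sqrt ρ / (3 * M ^ 3)) ^ ((1 : ℝ) / 17) ≤ 1 / 2 ∧
      C₁ * (8 * Real.pi * a ^ 3 * Real.sqrt ρ / (3 * M ^ 3)) ^ ((1 : ℝ) / 17) ≤ 1 / 2 ∧
      C₂ * (8 * Real.pi * a ^ 3 * Real.sqrt ρ / (3 * M ^ 3)) ^ ((1 : ℝ) / 17) ≤ 1 / 2 ∧
      C₂' * (Real.pi * a ^ 3 * Real.sqrt ρ / (6 * M ^ 3)) ^ (-(6 : ℝ) / 17) < M / (a * Real.sqrt ρ) ∧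
      Real.sqrt ρ * (1 / (2 * C₄ * M ^ 2) + 8 * Real.pi * a) ≤ Real.pi * a / (8 * M ^ 3) ∧
      Cu * (ρ * a ^ 3) ^ ((1 : ℝ) / 3) ≤ 1 ∧
      32 * Real.pi * C₄ * M ^ 2 * a * (Cu * (ρ * a ^ 3) ^ ((1 : ℝ) / 3) +
          C₁ * (8 * Real.pi * a ^ 3 * Real.sqrt ρ / (3 * M ^ 3)) ^ ((1 : ℝ) / 17)) +
        16 * Real.pi * C₄ * a * (6 * M ^ 3 / (Real.pi * a ^ 3 * (ρ * Real.sqrt ρ))) ^ ((1 : ℝ) / 18) *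
          Real.sqrt ρ / M +
        (6 * M ^ 3 / (Real.pi * a ^ 3 * (ρ * Real.sqrt ρ))) ^ ((1 : ℝ) / 18) * Real.sqrt ρ / M ^ 3 +
        8 * Real.pi * C₄ * a * ρ *
          ((Real.pi * 4 / 3) * a ^ 3 *
            (Real.pi * a ^ 3 * (ρ * Real.sqrt ρ) / (6 * M ^ 3)) ^ (-(15 : ℝ) / 17) *
              (2 / ρ) ^ ((2 : ℝ) / 17)) ^ ((2 : ℝ) / 3) ≤ 1 / 16 := by
  -- the basic small quantities, as functions of `ρ`
  set Ymax : ℝ → ℝ := fun ρ => 8 * Real.pi * a ^ 3 * Real.sqrt ρ / (3 * M ^ 3) with hYmax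
  set c18 : ℝ := (6 * M ^ 3 / (Real.pi * a ^ 3)) ^ ((1 : ℝ) / 18) with hc18
  set cw : ℝ := ((Real.pi * 4 / 3) * a ^ 3 * (Real.pi * a ^ 3 / (6 * M ^ 3)) ^ (-(15 : ℝ) / 17) *
    (2 : ℝ) ^ ((2 : ℝ) / 17)) ^ ((2 : ℝ) / 3) with hcw
  -- (1) `Ymax → 0`, `Ymax^{1/17} → 0`
  have hY : Tendsto Ymax (𝓝[>] 0) (𝓝 0) :=
    tendsto_zero_of_eq_const_mul_sqrt_rpow (8 * Real.pi * a ^ 3 / (3 * M ^ 3)) one_pos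
      (fun ρ _ => by rw [hYmax]; simp only [Real.rpow_one]; ring)
  have hY17 : Tendsto (fun ρ => Ymax ρ ^ ((1 : ℝ) / 17)) (𝓝[>] 0) (𝓝 0) := by
    have := (Real.continuousAt_rpow_const 0 ((1 : ℝ) / 17) (Or.inr (by norm_num))).tendsto
    simp only [Real.zero_rpow (by norm_num : ((1 : ℝ) / 17) ≠ 0)] at this
    exact this.comp hY
  -- (2) `(ρa³)^{1/3} → 0`
  have ht3 : Tendsto (fun ρ : ℝ => (ρ * a ^ 3) ^ ((1 : ℝ) / 3)) (𝓝[>] 0) (𝓝 0) := by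
    have hc : Continuous fun ρ : ℝ => (ρ * a ^ 3) ^ ((1 : ℝ) / 3) :=
      (continuous_id.mul continuous_const).rpow_const fun _ => Or.inr (by norm_num)
    have := hc.tendsto 0
    simp only [zero_mul, Real.zero_rpow (by norm_num : ((1 : ℝ) / 3) ≠ 0)] at this
    exact this.mono_left nhdsWithin_le_nhds
  -- (3) `lambar √ρ = c18 (√ρ)^{5/6}`
  have hlam : ∀ ρ : ℝ, 0 < ρ →
      (6 * M ^ 3 / (Real.pi * a ^ 3 * (ρ * Real.sqrt ρ))) ^ ((1 : ℝ) / 18) * Real.sqrt ρ =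
        c18 * Real.sqrt ρ ^ ((5 : ℝ) / 6) := by
    intro ρ hρ
    have ht : 0 < Real.sqrt ρ := Real.sqrt_pos.2 hρ
    have hρt : ρ * Real.sqrt ρ = Real.sqrt ρ ^ (3 : ℝ) := by
      rw [show (3 : ℝ) = 2 + 1 by norm_num, Real.rpow_add ht, Real.rpow_two, Real.sq_sqrt hρ.le,
        Real.rpow_one]
    have h1 : 6 * M ^ 3 / (Real.pi * a ^ 3 * (ρ * Real.sqrt ρ)) =
        (6 * M ^ 3 / (Real.pi * a ^ 3)) * Real.sqrt ρ ^ (-(3 : ℝ)) := by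
      rw [hρt, Real.rpow_neg ht.le]; field_simp
    rw [h1, Real.mul_rpow (by positivity) (Real.rpow_nonneg ht.le _), ← Real.rpow_mul ht.le, hc18,
      mul_assoc, ← Real.rpow_add_one ht.ne']
    norm_num
  have hlamt : Tendsto (fun ρ : ℝ =>
      (6 * M ^ 3 / (Real.pi * a ^ 3 * (ρ * Real.sqrt ρ))) ^ ((1 : ℝ) / 18) * Real.sqrt ρ)
      (𝓝[>] 0) (𝓝 0) :=
    tendsto_zero_of_eq_const_mul_sqrt_rpow c18 (by norm_num) hlam
  -- (4) `ρ wbar = cw (√ρ)^{4/51}`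
  have hw : ∀ ρ : ℝ, 0 < ρ →
      ρ * ((Real.pi * 4 / 3) * a ^ 3 *
        (Real.pi * a ^ 3 * (ρ * Real.sqrt ρ) / (6 * M ^ 3)) ^ (-(15 : ℝ) / 17) *
          (2 / ρ) ^ ((2 : ℝ) / 17)) ^ ((2 : ℝ) / 3) = cw * Real.sqrt ρ ^ ((4 : ℝ) / 51) := by
    intro ρ hρ
    have ht : 0 < Real.sqrt ρ := Real.sqrt_pos.2 hρ
    set t := Real.sqrt ρ with htdef
    have hρt2 : ρ = t ^ (2 : ℝ) := by rw [Real.rpow_two, htdef, Real.sq_sqrt hρ.le]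
    have hρt : ρ * t = t ^ (3 : ℝ) := by
      rw [hρt2, show (3 : ℝ) = 2 + 1 by norm_num, Real.rpow_add ht, Real.rpow_one]
    have h1 : Real.pi * a ^ 3 * (ρ * t) / (6 * M ^ 3) = (Real.pi * a ^ 3 / (6 * M ^ 3)) * t ^ (3 : ℝ) := by
      rw [hρt]; ring
    have h2 : (2 : ℝ) / ρ = 2 * t ^ (-(2 : ℝ)) := by
      rw [hρt2, Real.rpow_neg ht.le, div_eq_mul_inv]
    have hA : 0 ≤ Real.pi * 4 / 3 * a ^ 3 := by positivity
    have hB : 0 < Real.pi * a ^ 3 / (6 * M ^ 3) := by positivity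
    rw [h1, h2, Real.mul_rpow hB.le (Real.rpow_nonneg ht.le _), ← Real.rpow_mul ht.le,
      Real.mul_rpow (by norm_num) (Real.rpow_nonneg ht.le _), ← Real.rpow_mul ht.le]
    -- collect the powers of `t`
    have h3 : Real.pi * 4 / 3 * a ^ 3 * ((Real.pi * a ^ 3 / (6 * M ^ 3)) ^ (-(15 : ℝ) / 17) *
        t ^ ((3 : ℝ) * (-(15 : ℝ) / 17))) * ((2 : ℝ) ^ ((2 : ℝ) / 17) * t ^ (-(2 : ℝ) * ((2 : ℝ) / 17))) =
        (Real.pi * 4 / 3 * a ^ 3 * (Real.pi * a ^ 3 / (6 * M ^ 3)) ^ (-(15 : ℝ) / 17) *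
          (2 : ℝ) ^ ((2 : ℝ) / 17)) * t ^ (-(49 : ℝ) / 17) := by
      rw [show (-(49 : ℝ) / 17) = (3 : ℝ) * (-(15 : ℝ) / 17) + (-(2 : ℝ) * ((2 : ℝ) / 17)) by norm_num,
        Real.rpow_add ht]
      ring
    rw [h3, Real.mul_rpow (by positivity) (Real.rpow_nonneg ht.le _), ← Real.rpow_mul ht.le, ← hcw,
      hρt2, mul_comm, mul_assoc, ← Real.rpow_add ht]
    norm_num
  have hwt : Tendsto (fun ρ : ℝ => ρ * ((Real.pi * 4 / 3) * a ^ 3 *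
      (Real.pi * a ^ 3 * (ρ * Real.sqrt ρ) / (6 * M ^ 3)) ^ (-(15 : ℝ) / 17) *
        (2 / ρ) ^ ((2 : ℝ) / 17)) ^ ((2 : ℝ) / 3)) (𝓝[>] 0) (𝓝 0) :=
    tendsto_zero_of_eq_const_mul_sqrt_rpow cw (by norm_num) hw
  -- (5) the strict box condition, in product form: `C₂' Ymin^{-6/17} a√ρ/M → 0`
  have hbox : ∀ ρ : ℝ, 0 < ρ →
      C₂' * (Real.pi * a ^ 3 * Real.sqrt ρ / (6 * M ^ 3)) ^ (-(6 : ℝ) / 17) * (a * Real.sqrt ρ / M) =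
        (C₂' * (Real.pi * a ^ 3 / (6 * M ^ 3)) ^ (-(6 : ℝ) / 17) * a / M) *
          Real.sqrt ρ ^ ((11 : ℝ) / 17) := by
    intro ρ hρ
    have ht : 0 < Real.sqrt ρ := Real.sqrt_pos.2 hρ
    have h1 : Real.pi * a ^ 3 * Real.sqrt ρ / (6 * M ^ 3) = (Real.pi * a ^ 3 / (6 * M ^ 3)) * Real.sqrt ρ := by
      ring
    rw [h1, Real.mul_rpow (by positivity) ht.le]
    have h2 : Real.sqrt ρ ^ (-(6 : ℝ) / 17) * Real.sqrt ρ = Real.sqrt ρ ^ ((11 : ℝ) / 17) := by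
      rw [← Real.rpow_add_one ht.ne']; norm_num
    calc _ = (C₂' * (Real.pi * a ^ 3 / (6 * M ^ 3)) ^ (-(6 : ℝ) / 17) * a / M) *
          (Real.sqrt ρ ^ (-(6 : ℝ) / 17) * Real.sqrt ρ) := by field_simp
      _ = _ := by rw [h2]
  have hboxt : Tendsto (fun ρ : ℝ =>
      C₂' * (Real.pi * a ^ 3 * Real.sqrt ρ / (6 * M ^ 3)) ^ (-(6 : ℝ) / 17) * (a * Real.sqrt ρ / M))
      (𝓝[>] 0) (𝓝 0) :=
    tendsto_zero_of_eq_const_mul_sqrt_rpow _ (by norm_num) hbox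
  -- (6) the penalty condition: `√ρ (…) → 0`
  have hpen : Tendsto (fun ρ : ℝ => Real.sqrt ρ * (1 / (2 * C₄ * M ^ 2) + 8 * Real.pi * a))
      (𝓝[>] 0) (𝓝 0) :=
    tendsto_zero_of_eq_const_mul_sqrt_rpow (1 / (2 * C₄ * M ^ 2) + 8 * Real.pi * a) one_pos
      (fun ρ _ => by rw [Real.rpow_one]; ring)
  -- (7) the budget sum → 0
  have hsum : Tendsto (fun ρ : ℝ =>
      32 * Real.pi * C₄ * M ^ 2 * a * (Cu * (ρ * a ^ 3) ^ ((1 : ℝ) / 3) + C₁ * Ymax ρ ^ ((1 : ℝ) / 17)) +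
        16 * Real.pi * C₄ * a *
          ((6 * M ^ 3 / (Real.pi * a ^ 3 * (ρ * Real.sqrt ρ))) ^ ((1 : ℝ) / 18) * Real.sqrt ρ) / M +
        (6 * M ^ 3 / (Real.pi * a ^ 3 * (ρ * Real.sqrt ρ))) ^ ((1 : ℝ) / 18) * Real.sqrt ρ / M ^ 3 +
        8 * Real.pi * C₄ * a * (ρ * ((Real.pi * 4 / 3) * a ^ 3 *
          (Real.pi * a ^ 3 * (ρ * Real.sqrt ρ) / (6 * M ^ 3)) ^ (-(15 : ℝ) / 17) *
            (2 / ρ) ^ ((2 : ℝ) / 17)) ^ ((2 : ℝ) / 3))) (𝓝[>] 0) (𝓝 0) := by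
    have h1 : Tendsto (fun ρ : ℝ => 32 * Real.pi * C₄ * M ^ 2 * a *
        (Cu * (ρ * a ^ 3) ^ ((1 : ℝ) / 3) + C₁ * Ymax ρ ^ ((1 : ℝ) / 17))) (𝓝[>] 0) (𝓝 0) := by
      simpa using ((ht3.const_mul Cu).add (hY17.const_mul C₁)).const_mul (32 * Real.pi * C₄ * M ^ 2 * a)
    have h2 : Tendsto (fun ρ : ℝ => 16 * Real.pi * C₄ * a *
        ((6 * M ^ 3 / (Real.pi * a ^ 3 * (ρ * Real.sqrt ρ))) ^ ((1 : ℝ) / 18) * Real.sqrt ρ) / M)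
        (𝓝[>] 0) (𝓝 0) := by
      simpa using (hlamt.const_mul (16 * Real.pi * C₄ * a)).div_const M
    have h3 : Tendsto (fun ρ : ℝ =>
        (6 * M ^ 3 / (Real.pi * a ^ 3 * (ρ * Real.sqrt ρ))) ^ ((1 : ℝ) / 18) * Real.sqrt ρ / M ^ 3)
        (𝓝[>] 0) (𝓝 0) := by
      simpa using hlamt.div_const (M ^ 3)
    have h4 : Tendsto (fun ρ : ℝ => 8 * Real.pi * C₄ * a * (ρ * ((Real.pi * 4 / 3) * a ^ 3 *
        (Real.pi * a ^ 3 * (ρ * Real.sqrt ρ) / (6 * M ^ 3)) ^ (-(15 : ℝ) / 17) *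
          (2 / ρ) ^ ((2 : ℝ) / 17)) ^ ((2 : ℝ) / 3))) (𝓝[>] 0) (𝓝 0) := by
      simpa using hwt.const_mul (8 * Real.pi * C₄ * a)
    simpa using ((h1.add h2).add h3).add h4
  -- collect the eventualities
  have e0 : ∀ᶠ ρ in 𝓝[>] (0 : ℝ), 0 < ρ ∧ ρ ≤ 1 := by
    filter_upwards [Ioo_mem_nhdsGT (zero_lt_one' ℝ)] with ρ hρ using ⟨hρ.1, hρ.2.le⟩
  have e1 := (tendsto_order.1 hY).2 δ₁ hδ₁
  have e2 := (tendsto_order.1 hY).2 δ₂ hδ₂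
  have e3 := (tendsto_order.1 hY17).2 (1 / 2) (by norm_num)
  have e4 : ∀ᶠ ρ in 𝓝[>] (0 : ℝ), C₁ * Ymax ρ ^ ((1 : ℝ) / 17) < 1 / 2 := by
    have := hY17.const_mul C₁
    simp only [mul_zero] at this
    exact (tendsto_order.1 this).2 (1 / 2) (by norm_num)
  have e5 : ∀ᶠ ρ in 𝓝[>] (0 : ℝ), C₂ * Ymax ρ ^ ((1 : ℝ) / 17) < 1 / 2 := by
    have := hY17.const_mul C₂
    simp only [mul_zero] at this
    exact (tendsto_order.1 this).2 (1 / 2) (by norm_num)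
  have e6 := (tendsto_order.1 hboxt).2 1 one_pos
  have e7 := (tendsto_order.1 hpen).2 (Real.pi * a / (8 * M ^ 3)) (by positivity)
  have e8 : ∀ᶠ ρ in 𝓝[>] (0 : ℝ), Cu * (ρ * a ^ 3) ^ ((1 : ℝ) / 3) < 1 := by
    have := ht3.const_mul Cu
    simp only [mul_zero] at this
    exact (tendsto_order.1 this).2 1 one_pos
  have e9 := (tendsto_order.1 hsum).2 (1 / 16) (by norm_num)
  refine exists_pos_forall_of_eventually ?_
  filter_upwards [e0, e1, e2, e3, e4, e5, e6, e7, e8, e9] with ρ h0 h1 h2 h3 h4 h5 h6 h7 h8 h9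
  have hρ := h0.1
  have hsr : 0 < Real.sqrt ρ := Real.sqrt_pos.2 hρ
  simp only [hYmax] at h1 h2 h3 h4 h5 h9
  refine ⟨h0.2, h1, h2, h3.le, h4.le, h5.le, ?_, h7.le, h8.le, Eq.trans_le (by ring) h9.le⟩
  -- unfold the product form of the box condition
  have hpos : 0 < a * Real.sqrt ρ / M := by positivity
  have := (lt_div_iff₀ hpos).2 h6
  rwa [one_div_div] at this

end Dilute



/-! ### The case of zero scattering length: the kinetic gap suffices -/

/-- For zero scattering length the periodic energies per particle vanish eventually along the
fixed-density box sequence (Dyson–LSSY upper bound with `a = 0`), hence `e₀(ρ) = 0` below the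
density cap. [folklore] -/
theorem e0_eq_zero_of_scatteringLength_zero {v : ℝ → ℝ≥0∞} (hv : IsRepulsiveFiniteRange v)
    (h0 : scatteringLength v = 0) {ρ : ℝ} (hρ : 0 < ρ)
    (hP : Tendsto (energyPerParticlePeriodic v ρ) atTop (𝓝 (e0 v ρ))) : e0 v ρ = 0 := by
  obtain ⟨R₀, hR₀⟩ := hv.2
  have hfin : scatteringLength v ≠ ⊤ := scatteringLength_ne_top_of_finiteRange hR₀
  obtain ⟨C, c, hC, hc, Hper⟩ := LSSY2005_upperBound_periodic_holds v R₀ hv.1 hR₀ hfin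
  have hzero : ∀ᶠ N : ℕ in atTop, energyPerParticlePeriodic v ρ N = 0 := by
    filter_upwards [eventually_ge_atTop 2,
      (tendsto_sideLength_atTop hρ).eventually_gt_atTop (2 * R₀)] with N hN hL
    have hNpos : 0 < N := by omega
    have hLpos : 0 < sideLength ρ N := sideLength_pos_of_pos hρ hNpos
    have h := Hper N (sideLength ρ N) hN hLpos hL (by
      show (scatteringLength v).toReal / _ ≤ c
      rw [h0, ENNReal.toReal_zero, zero_div]; exact hc.le)
    have h' : periodicGroundStateEnergy v N (sideLength ρ N) ≤ 0 := by
      refine h.trans (le_of_eq ?_)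
      rw [h0, ENNReal.toReal_zero]; simp
    rw [energyPerParticlePeriodic, le_antisymm h' bot_le, ENNReal.zero_div]
  have hT : Tendsto (energyPerParticlePeriodic v ρ) atTop (𝓝 0) :=
    tendsto_const_nhds.congr' (hzero.mono fun N hN => hN.symm)
  exact tendsto_nhds_unique hP hT

/-- **The free-like case.** For zero scattering length, at every scale `ℓ = M/√ρ` the sub-cell
constant modes of side `L/2^k ∈ [ℓ, 2ℓ)` carry at least `7N/8` particles of every `1`-near-minimiser,
eventually in `N` (the sharp cell gap `key_inequality` and `E₀^D(N, L_N) = o(N)`). [folklore] -/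
theorem floor_of_scatteringLength_zero {v : ℝ → ℝ≥0∞} (hv : IsRepulsiveFiniteRange v)
    (h0 : scatteringLength v = 0) {M : ℝ} (hM : 0 < M) :
    ∃ ρ₀ : ℝ, 0 < ρ₀ ∧ ∀ ρ : ℝ, 0 < ρ → ρ < ρ₀ →
      ∀ᶠ N : ℕ in atTop, ∀ Ψ : TrialState N (sideLength ρ N),
        energy v Ψ ≤ groundStateEnergy v N (sideLength ρ N) + 1 →
        ∀ k : ℕ, M / Real.sqrt ρ ≤ sideLength ρ N / 2 ^ k →
          sideLength ρ N / 2 ^ k < 2 * (M / Real.sqrt ρ) →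
            ENNReal.ofReal (7 * (N : ℝ) / 8) ≤
              ∑ q : SubIdx (2 ^ k), occupation N (subMode (sideLength ρ N / 2 ^ k) q) Ψ.ψ := by
  obtain ⟨ρ₂, hρ₂, Hcap⟩ := exists_density_cap_tendsto_e0 v hv
  refine ⟨ρ₂, hρ₂, fun ρ hρ hρlt => ?_⟩
  obtain ⟨-, hD, hP⟩ := Hcap ρ hρ hρlt
  have he0 := e0_eq_zero_of_scatteringLength_zero hv h0 hρ hP
  rw [he0] at hD
  -- the energy slack `ε = π²ρ/(64M²)`
  set ε : ℝ := Real.pi ^ 2 * ρ / (64 * M ^ 2) with hε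
  have hεpos : 0 < ε := by positivity
  have hE0 : ∀ᶠ N : ℕ in atTop, groundStateEnergy v N (sideLength ρ N) ≤ ENNReal.ofReal ε * N := by
    have h := (tendsto_order.1 hD).2 (ENNReal.ofReal ε) (by simpa using hεpos)
    filter_upwards [h, eventually_gt_atTop 0] with N hN hNpos
    rw [energyPerParticleDirichlet, ENNReal.div_lt_iff (Or.inl (by exact_mod_cast hNpos.ne'))
      (Or.inl (ENNReal.natCast_ne_top N))] at hN
    exact hN.le
  have hN1 : ∀ᶠ N : ℕ in atTop, 64 * M ^ 2 / (Real.pi ^ 2 * ρ) ≤ (N : ℝ) :=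
    tendsto_natCast_atTop_atTop.eventually_ge_atTop _
  filter_upwards [hE0, hN1, eventually_gt_atTop 0] with N hE0N hN1N hNpos Ψ hΨ k hk1 hk2
  obtain ⟨n, rfl⟩ : ∃ n, N = n + 1 := ⟨N - 1, by omega⟩
  set s := sideLength ρ (n + 1) / 2 ^ k with hs
  have hsr : 0 < Real.sqrt ρ := Real.sqrt_pos.2 hρ
  have hspos : 0 < s := lt_of_lt_of_le (by positivity) hk1
  have hKs : ((2 ^ k : ℕ) : ℝ) * s = sideLength ρ (n + 1) := by rw [hs]; push_cast; field_simp
  -- the key inequality and the energy bound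
  have hkey := key_inequality (k := 2 ^ k) hspos hKs Ψ
  set c : ℝ≥0∞ := ENNReal.ofReal ((Real.pi / s) ^ 2) with hc
  have hc0 : c ≠ 0 := by rw [hc, ne_eq, ENNReal.ofReal_eq_zero, not_le]; positivity
  have hctop : c ≠ ⊤ := ENNReal.ofReal_ne_top
  have hE : energy 0 Ψ ≤ ENNReal.ofReal ε * (n + 1 : ℕ) + 1 := by
    have h1 : energy 0 Ψ ≤ energy v Ψ := lintegral_mono fun X => by simp
    exact h1.trans (hΨ.trans (add_le_add hE0N le_rfl))
  -- `ε N + 1 ≤ c · N/8`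
  have hcs : Real.pi ^ 2 * ρ / (4 * M ^ 2) ≤ (Real.pi / s) ^ 2 := by
    have h2s : s ≤ 2 * M / Real.sqrt ρ := by rw [mul_div_assoc]; exact hk2.le
    have h1 : s * Real.sqrt ρ ≤ 2 * M := by rwa [le_div_iff₀ hsr] at h2s
    have h2 : (s * Real.sqrt ρ) ^ 2 ≤ (2 * M) ^ 2 := pow_le_pow_left₀ (by positivity) h1 2
    rw [mul_pow, Real.sq_sqrt hρ.le] at h2
    rw [div_pow, div_le_div_iff₀ (by positivity) (by positivity)]
    nlinarith [Real.pi_pos]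
  have hslack : ENNReal.ofReal ε * (n + 1 : ℕ) + 1 ≤ c * ENNReal.ofReal (((n + 1 : ℕ) : ℝ) / 8) := by
    have hNr : (0 : ℝ) < (n + 1 : ℕ) := by positivity
    rw [hc, ← ENNReal.ofReal_natCast, ← ENNReal.ofReal_mul hεpos.le, ← ENNReal.ofReal_one,
      ← ENNReal.ofReal_add (by positivity) zero_le_one, ← ENNReal.ofReal_mul (by positivity)]
    refine ENNReal.ofReal_le_ofReal ?_
    have h1 : (1 : ℝ) ≤ Real.pi ^ 2 * ρ / (64 * M ^ 2) * (n + 1 : ℕ) := by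
      rw [div_mul_eq_mul_div, le_div_iff₀ (by positivity)]
      rw [div_le_iff₀ (by positivity)] at hN1N
      linarith
    have h2 : ε * (n + 1 : ℕ) + 1 ≤ Real.pi ^ 2 * ρ / (4 * M ^ 2) * (((n + 1 : ℕ) : ℝ) / 8) := by
      have h3 : Real.pi ^ 2 * ρ / (4 * M ^ 2) * (((n + 1 : ℕ) : ℝ) / 8) =
          2 * (Real.pi ^ 2 * ρ / (64 * M ^ 2) * (n + 1 : ℕ)) := by ring
      rw [h3, hε]
      linarith
    exact h2.trans (mul_le_mul_of_nonneg_right hcs (by positivity))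
  -- conclude: `c·N ≤ c·N/8 + c·S`
  have hsplit : ((n : ℝ≥0∞) + 1) = ENNReal.ofReal (7 * ((n + 1 : ℕ) : ℝ) / 8) +
      ENNReal.ofReal (((n + 1 : ℕ) : ℝ) / 8) := by
    rw [← ENNReal.ofReal_add (by positivity) (by positivity),
      show ((n : ℝ≥0∞) + 1) = ((n + 1 : ℕ) : ℝ≥0∞) by push_cast; rfl, ← ENNReal.ofReal_natCast]
    congr 1; ring
  have hmain : c * ENNReal.ofReal (7 * ((n + 1 : ℕ) : ℝ) / 8) + c * ENNReal.ofReal (((n + 1 : ℕ) : ℝ) / 8) ≤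
      c * ENNReal.ofReal (((n + 1 : ℕ) : ℝ) / 8) +
        c * ∑ q : SubIdx (2 ^ k), occupation (n + 1) (subMode s q) Ψ.ψ := by
    calc _ = c * ((n : ℝ≥0∞) + 1) := by rw [hsplit, mul_add]
      _ ≤ energy 0 Ψ + c * ∑ q : SubIdx (2 ^ k), occupation (n + 1) (subMode s q) Ψ.ψ := hkey
      _ ≤ _ := add_le_add (hE.trans hslack) le_rfl
  have h2 : c * ENNReal.ofReal (7 * ((n + 1 : ℕ) : ℝ) / 8) ≤
      c * ∑ q : SubIdx (2 ^ k), occupation (n + 1) (subMode s q) Ψ.ψ := by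
    rw [add_comm (c * ENNReal.ofReal (7 * ((n + 1 : ℕ) : ℝ) / 8))] at hmain
    exact (ENNReal.add_le_add_iff_left (ENNReal.mul_ne_top hctop ENNReal.ofReal_ne_top)).1 hmain
  exact (ENNReal.mul_le_mul_iff_right hc0 hctop).1 h2


/-! ## The mesoscopic floor, pinned -/

section Final

/-- **The interacting case of the pinned mesoscopic floor.**  For a repulsive finite-range `v` with
positive scattering length and every `M > 0` there is `ρ₀ > 0` such that for `0 < ρ < ρ₀`, at the
scale `ℓ = M/√ρ`, eventually in `N`, every `1`-near-minimiser of the Dirichlet energy in the box of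
side `L = (N/ρ)^{1/3}` has `∑_q ⟨u_q, γ_Ψ u_q⟩ ≥ 7N/8` at every dyadic level `k` with
`ℓ ≤ L/2^k < 2ℓ`. [folklore] -/
theorem floor_of_scatteringLength_pos {v : ℝ → ℝ≥0∞} (hv : IsRepulsiveFiniteRange v)
    (hapos : 0 < scatteringLength v) {M : ℝ} (hM : 0 < M) :
    ∃ ρ₀ : ℝ, 0 < ρ₀ ∧ ∀ ρ : ℝ, 0 < ρ → ρ < ρ₀ →
      ∀ᶠ N : ℕ in atTop, ∀ Ψ : TrialState N (sideLength ρ N),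
        energy v Ψ ≤ groundStateEnergy v N (sideLength ρ N) + 1 →
        ∀ k : ℕ, M / Real.sqrt ρ ≤ sideLength ρ N / 2 ^ k →
          sideLength ρ N / 2 ^ k < 2 * (M / Real.sqrt ρ) →
            ENNReal.ofReal (7 * (N : ℝ) / 8) ≤
              ∑ q : SubIdx (2 ^ k), occupation N (subMode (sideLength ρ N / 2 ^ k) q) Ψ.ψ := by
  obtain ⟨R₀, hR₀⟩ := hv.2
  have hfin : scatteringLength v ≠ ⊤ := scatteringLength_ne_top_of_finiteRange hR₀
  set a : ℝ := (scatteringLength v).toReal with ha_def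
  have ha : 0 < a := ENNReal.toReal_pos hapos.ne' hfin
  obtain ⟨δ₁, C₁, hδ₁, hC₁, Hloc⟩ := locLowerBound_neumann v hv
  obtain ⟨δ₂, C₂, C₂', hδ₂, hC₂, hC₂', HLY⟩ := LSSY2005_lowerBound_neumann_holds v hv hfin
  obtain ⟨C₄, hC₄, H41⟩ := LSSY2005_lemma41_holds
  obtain ⟨Cu, ρu, hCu, hρu, Hup⟩ := eventually_groundStateEnergy_le_dyson hR₀ hv.1 hfin hapos
  obtain ⟨ρp, hρp, Hpar⟩ := floorParams_eventually (C₁ := C₁) (C₂ := C₂) (C₂' := C₂') (C₄ := C₄)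
    (Cu := Cu) ha hM hδ₁ hδ₂
  refine ⟨min ρp ρu, lt_min hρp hρu, fun ρ hρ hρlt => ?_⟩
  have hρp' : ρ < ρp := lt_of_lt_of_le hρlt (min_le_left _ _)
  have hρu' : ρ < ρu := lt_of_lt_of_le hρlt (min_le_right _ _)
  obtain ⟨hρ1, hYδ₁, hYδ₂, hy12, hθ12, hC2y, hbox, hpen, ht1, hbud⟩ := Hpar ρ hρ hρp'
  have hsr : 0 < Real.sqrt ρ := Real.sqrt_pos.2 hρ
  obtain ⟨hmth1, hmth2, hmth3⟩ := ceil_inv_bounds hρ hρ1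
  set mth : ℕ := ⌈ρ⁻¹⌉₊ with hmth_def
  have hmthr : (0 : ℝ) < mth := by exact_mod_cast hmth3
  -- density-only quantities
  set Ymax : ℝ := 8 * Real.pi * a ^ 3 * Real.sqrt ρ / (3 * M ^ 3) with hYmax
  set θ : ℝ := C₁ * Ymax ^ ((1 : ℝ) / 17) with hθ_def
  have hθ0 : 0 ≤ θ := by positivity
  set lambar : ℝ := (6 * M ^ 3 / (Real.pi * a ^ 3 * (ρ * Real.sqrt ρ))) ^ ((1 : ℝ) / 18) with hlambar
  set wbar : ℝ := ((Real.pi * 4 / 3) * a ^ 3 *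
    (Real.pi * a ^ 3 * (ρ * Real.sqrt ρ) / (6 * M ^ 3)) ^ (-(15 : ℝ) / 17) *
      (2 / ρ) ^ ((2 : ℝ) / 17)) ^ ((2 : ℝ) / 3) with hwbar
  -- thresholds in `N`
  filter_upwards [Hup ρ hρ hρu',
    tendsto_natCast_atTop_atTop.eventually_ge_atTop (16 * (8 * C₄ * M ^ 2 / ρ + C₄ * wbar)),
    eventually_gt_atTop 0] with N hUp hN1 hNpos Ψ hΨ k hk1 hk2
  obtain ⟨n, rfl⟩ : ∃ n, N = n + 1 := ⟨N - 1, by omega⟩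
  -- the scale
  set s : ℝ := sideLength ρ (n + 1) / 2 ^ k with hs_def
  have hs : 0 < s := lt_of_lt_of_le (by positivity) hk1
  have hsl : M / Real.sqrt ρ ≤ s := hk1
  have hsu : s ≤ 2 * M / Real.sqrt ρ := by rw [mul_div_assoc]; exact hk2.le
  have hL : 0 < sideLength ρ (n + 1) := sideLength_pos_of_pos hρ (Nat.succ_pos n)
  have hK : 0 < 2 ^ k := pow_pos two_pos k
  have hKs : ((2 ^ k : ℕ) : ℝ) * s = sideLength ρ (n + 1) := by
    rw [hs_def]; push_cast; field_simp
  have hKc : (0 : ℝ) < (((2 ^ k) ^ 3 : ℕ) : ℝ) := by positivity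
  have hKN : (((n + 1 : ℕ) : ℝ)) / (((2 ^ k) ^ 3 : ℕ) : ℝ) = ρ * s ^ 3 := by
    have h3 := sideLength_pow_three hρ (n + 1)
    rw [← hKs] at h3
    push_cast at h3
    rw [div_eq_iff hKc.ne']
    push_cast
    field_simp at h3
    linarith [h3]
  -- cell quantities
  set Yc : ℕ → ℝ := fun m => 4 * Real.pi * ((m : ℝ) / s ^ 3) * a ^ 3 / 3 with hYc
  have hYc0 : ∀ m, 0 ≤ Yc m := fun m => by rw [hYc]; positivity
  set good : ℕ → Prop := fun m => Yc m ^ (-(1 : ℝ) / 17) ≤ m ∧ (m : ℝ) ≤ mth with hgood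
  set yf : ℕ → ℝ := fun m => Yc m ^ ((1 : ℝ) / 17) with hyf
  set Rf : ℕ → ℝ := fun m => a * Yc m ^ (-(5 : ℝ) / 17) with hRf
  set LYval : ℝ := 4 * Real.pi * ((mth : ℝ) / s ^ 3) * a * (1 - C₂ * Yc mth ^ ((1 : ℝ) / 17)) * mth
    with hLYval
  set lb : ℕ → ℝ := fun m => if good m then 4 * Real.pi * ((m : ℝ) / s ^ 3) * a * (1 - C₁ * yf m) * m
    else if (m : ℝ) ≤ mth then 0 else ((m / mth : ℕ) : ℝ) * LYval with hlb
  set lam : ℝ := (3 * s ^ 3 / (4 * Real.pi * a ^ 3)) ^ ((1 : ℝ) / 18) with hlam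
  set w : ℝ := ((Real.pi * 4 / 3) * a ^ 3 * (4 * Real.pi * a ^ 3 / (3 * s ^ 3)) ^ (-(15 : ℝ) / 17) *
    (mth : ℝ) ^ ((2 : ℝ) / 17)) ^ ((2 : ℝ) / 3) with hw_def
  set κ : ℝ := 1 / (2 * C₄ * s ^ 2) with hκ_def
  set Ur : ℝ := 4 * Real.pi * ρ * a * (1 + Cu * (ρ * a ^ 3) ^ ((1 : ℝ) / 3)) * ((n : ℝ) + 1) + 1
    with hUr
  set A : ℝ := (1 - θ) * (4 * Real.pi * a / s ^ 3) * (((n + 1 : ℕ) : ℝ)) ^ 2 / (((2 ^ k) ^ 3 : ℕ) : ℝ)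
    with hA_def
  set B : ℝ := (((2 ^ k) ^ 3 : ℕ) : ℝ) * lam *
    ((1 - θ) * (8 * Real.pi * a / s ^ 3) * ((((n + 1 : ℕ) : ℝ)) / (((2 ^ k) ^ 3 : ℕ) : ℝ)) + κ) with hB_def
  -- density bounds for good cells and at the threshold
  have hYmax_bd : ∀ m : ℕ, (m : ℝ) ≤ mth → Yc m ≤ Ymax := fun m hm =>
    cellY_le_Ymax ha hM hρ hsl hm hmth2
  have hYmin_bd : Real.pi * a ^ 3 * Real.sqrt ρ / (6 * M ^ 3) ≤ Yc mth :=
    Ymin_le_cellY ha hM hρ hsu hs hmth1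
  have hθm : ∀ m : ℕ, (m : ℝ) ≤ mth → C₁ * yf m ≤ θ := fun m hm => by
    rw [hyf, hθ_def]
    exact mul_le_mul_of_nonneg_left (Real.rpow_le_rpow (hYc0 m) (hYmax_bd m hm) (by norm_num)) hC₁.le
  have hθ1 : θ ≤ 1 / 2 := hθ12
  have hC2m : C₂ * Yc mth ^ ((1 : ℝ) / 17) ≤ 1 / 2 :=
    le_trans (mul_le_mul_of_nonneg_left (Real.rpow_le_rpow (hYc0 mth) (hYmax_bd mth le_rfl)
      (by norm_num)) hC₂.le) hC2y
  have hLYval : 2 * Real.pi * a * (mth : ℝ) ^ 2 / s ^ 3 ≤ LYval := by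
    rw [hLYval]
    have h1 : (1 : ℝ) / 2 ≤ 1 - C₂ * Yc mth ^ ((1 : ℝ) / 17) := by linarith
    calc 2 * Real.pi * a * (mth : ℝ) ^ 2 / s ^ 3
        = 4 * Real.pi * ((mth : ℝ) / s ^ 3) * a * (1 / 2) * mth := by field_simp; ring
      _ ≤ 4 * Real.pi * ((mth : ℝ) / s ^ 3) * a * (1 - C₂ * Yc mth ^ ((1 : ℝ) / 17)) * mth := by
          gcongr
  have hLYval0 : 0 ≤ LYval := le_trans (by positivity) hLYval
  ----------------------------------------------------------------
  -- the hypotheses of the deterministic floor inequality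
  ----------------------------------------------------------------
  have hW : ∀ m' : ℕ, good (m' + 1) →
      ((m' : ℝ≥0∞) * (ENNReal.ofReal (Rf (m' + 1)) ^ 3 * ENNReal.ofReal (Real.pi * 4 / 3))) ^
        (2 / 3 : ℝ) ≤ ENNReal.ofReal w := by
    intro m' hg
    have hm : (m' : ℝ) + 1 ≤ mth := by have := hg.2; push_cast at this; exact this
    have h := excludedVolume_rpow_le (s := s) ha hs hm
    rw [hw_def, hRf]
    exact h
  have hy : ∀ m, good m → 0 ≤ yf m ∧ yf m ≤ 1 / 2 := by
    intro m hg
    refine ⟨Real.rpow_nonneg (hYc0 m) _, ?_⟩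
    exact le_trans (Real.rpow_le_rpow (hYc0 m) (hYmax_bd m hg.2) (by norm_num)) hy12
  have hloc : ∀ m, good m → ENNReal.ofReal (lb m) ≤ locGroundStateEnergy (yf m) (Rf m) v m s := by
    intro m hg
    have hlbm : lb m = 4 * Real.pi * ((m : ℝ) / s ^ 3) * a * (1 - C₁ * yf m) * m := by
      rw [hlb]; simp only [hg, if_true]
    rw [hlbm]
    rcases Nat.eq_zero_or_pos m with rfl | hmpos
    · simp
    have hY1 : Yc m < δ₁ := lt_of_le_of_lt (hYmax_bd m hg.2) hYδ₁
    have hY2 : Yc m ^ (-(6 : ℝ) / 17) < s / a := rpow_lt_div_of_le hmpos hs ha hg.1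
    exact Hloc m s hs hY1 hY2
  have hE0 : ∀ m, ¬ good m → ENNReal.ofReal (lb m) ≤ neumannGroundStateEnergy v m s := by
    intro m hg
    by_cases hm : (m : ℝ) ≤ mth
    · have : lb m = 0 := by rw [hlb]; simp only [hg, if_false, hm, if_true]
      rw [this, ENNReal.ofReal_zero]; exact bot_le
    · have hlbm : lb m = ((m / mth : ℕ) : ℝ) * LYval := by
        rw [hlb]; simp only [hg, if_false, hm]
      rw [hlbm, ENNReal.ofReal_mul (Nat.cast_nonneg _), ENNReal.ofReal_natCast]
      -- the Lieb–Yngvason bound in the cell at the threshold occupation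
      have hY1 : Yc mth < δ₂ := lt_of_le_of_lt (hYmax_bd mth le_rfl) hYδ₂
      have hY2 : C₂' * Yc mth ^ (-(6 : ℝ) / 17) < s / a := by
        have h1 : Yc mth ^ (-(6 : ℝ) / 17) ≤
            (Real.pi * a ^ 3 * Real.sqrt ρ / (6 * M ^ 3)) ^ (-(6 : ℝ) / 17) :=
          Real.rpow_le_rpow_of_nonpos (by positivity) hYmin_bd (by norm_num)
        have h2 : M / (a * Real.sqrt ρ) ≤ s / a := by
          rw [div_le_div_iff₀ (by positivity) ha]
          have h3 : M ≤ s * Real.sqrt ρ := (div_le_iff₀ hsr).1 hsl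
          calc M * a ≤ s * Real.sqrt ρ * a := by gcongr
            _ = s * (a * Real.sqrt ρ) := by ring
        exact lt_of_le_of_lt (mul_le_mul_of_nonneg_left h1 hC₂'.le) (hbox.trans_le h2)
      have hLY : ENNReal.ofReal LYval ≤ neumannGroundStateEnergy v mth s := HLY mth s hs hY1 hY2
      have hsup := LSSY2005_superadditivity_holds.mul_le hv.1 hs mth (m / mth) (m % mth)
      rw [Nat.div_add_mod'] at hsup
      exact le_trans (mul_le_mul_right hLY _) hsup
  -- the occupation bookkeeping
  have hκcond : κ + (1 - θ) * (8 * Real.pi * a / s ^ 3) *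
      ((((n + 1 : ℕ) : ℝ)) / (((2 ^ k) ^ 3 : ℕ) : ℝ)) ≤ Real.pi * a * mth / s ^ 3 := by
    rw [hKN, hκ_def]
    exact kappa_condition ha hM hρ hC₄ hsl hsu hθ0 hmth1 hpen
  have hcomb : ∀ nv : Fin ((2 ^ k) ^ 3) → ℕ, ∑ c, nv c = n + 1 →
      ENNReal.ofReal A + ENNReal.ofReal κ * ∑ c, (if good (nv c) then 0 else (nv c : ℝ≥0∞)) ≤
        (∑ c, ENNReal.ofReal (lb (nv c))) + ENNReal.ofReal B := by
    intro nv hsum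
    rw [hA_def, hB_def]
    refine occupation_bookkeeping (mth := mth) good lb (lam := lam) (κh := Real.pi * a * mth / s ^ 3) hs ha.le
      (by linarith) (by positivity) (by positivity) ?_ ?_ ?_ hκcond nv hsum
    · -- good cells
      intro m hg
      have hlbm : lb m = 4 * Real.pi * ((m : ℝ) / s ^ 3) * a * (1 - C₁ * yf m) * m := by
        rw [hlb]; simp only [hg, if_true]
      rw [hlbm]
      have h1 : C₁ * yf m ≤ θ := hθm m hg.2
      have h2 : 0 ≤ 4 * Real.pi * a / s ^ 3 * (m : ℝ) ^ 2 := by positivity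
      calc (1 - θ) * (4 * Real.pi * a / s ^ 3) * (m : ℝ) ^ 2
          = (1 - θ) * (4 * Real.pi * a / s ^ 3 * (m : ℝ) ^ 2) := by ring
        _ ≤ (1 - C₁ * yf m) * (4 * Real.pi * a / s ^ 3 * (m : ℝ) ^ 2) :=
            mul_le_mul_of_nonneg_right (by linarith) h2
        _ = _ := by ring
    · -- low cells
      intro m hg hm
      have hlbm : lb m = 0 := by rw [hlb]; simp only [hg, if_false, hm, if_true]
      refine ⟨hlbm.ge, ?_⟩
      have hng : ¬ (Yc m ^ (-(1 : ℝ) / 17) ≤ m) := fun h => hg ⟨h, hm⟩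
      exact (lt_lam_of_not_rpow_le ha hs hng).2.le
    · -- high cells
      intro m hg hm
      have hm' : ¬ ((m : ℝ) ≤ mth) := not_le.2 hm
      have hlbm : lb m = ((m / mth : ℕ) : ℝ) * LYval := by rw [hlb]; simp only [hg, if_false, hm']
      rw [hlbm]
      have hmn : mth < m := by exact_mod_cast hm
      have hq := div_two_mul_le_nat_div hmth3 hmn
      calc Real.pi * a * mth / s ^ 3 * m = (m : ℝ) / (2 * mth) * (2 * Real.pi * a * (mth : ℝ) ^ 2 / s ^ 3) := by
            field_simp
        _ ≤ ((m / mth : ℕ) : ℝ) * LYval := mul_le_mul hq hLYval (by positivity) (Nat.cast_nonneg _)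
  have hκ1 : 1 ≤ 2 * C₄ * s ^ 2 * κ := by
    rw [hκ_def, show 2 * C₄ * s ^ 2 * (1 / (2 * C₄ * s ^ 2)) = 1 by field_simp]
  have hE : energy v Ψ ≤ ENNReal.ofReal Ur := by
    refine hΨ.trans ?_
    rw [hUr, ENNReal.ofReal_add (by positivity) zero_le_one, ENNReal.ofReal_one]
    rw [← ha_def] at hUp
    refine add_le_add (hUp.trans (le_of_eq ?_)) le_rfl
    norm_num
  have hA_eq : A = (1 - θ) * 4 * Real.pi * a * ρ * ((n : ℝ) + 1) := by
    rw [hA_def]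
    have h1 : (((n + 1 : ℕ) : ℝ)) ^ 2 / (((2 ^ k) ^ 3 : ℕ) : ℝ) =
        ((n + 1 : ℕ) : ℝ) * ((((n + 1 : ℕ) : ℝ)) / (((2 ^ k) ^ 3 : ℕ) : ℝ)) := by
      rw [pow_two, mul_div_assoc]
    rw [mul_div_assoc, h1, hKN]
    push_cast
    field_simp
  have hlam0 : 0 ≤ lam := by rw [hlam]; positivity
  have hB0 : 0 ≤ B := by
    rw [hB_def]
    exact mul_nonneg (mul_nonneg (Nat.cast_nonneg _) hlam0) (add_nonneg (mul_nonneg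
      (mul_nonneg (by linarith) (by positivity)) (by positivity)) (by rw [hκ_def]; positivity))
  have hUBA : A ≤ Ur + B := by
    have hP : 0 ≤ 4 * Real.pi * ρ * a * ((n : ℝ) + 1) := by positivity
    have ht0 : 0 ≤ Cu * (ρ * a ^ 3) ^ ((1 : ℝ) / 3) := by positivity
    calc A = (1 - θ) * (4 * Real.pi * ρ * a * ((n : ℝ) + 1)) := by rw [hA_eq]; ring
      _ ≤ (1 + Cu * (ρ * a ^ 3) ^ ((1 : ℝ) / 3)) * (4 * Real.pi * ρ * a * ((n : ℝ) + 1)) :=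
          mul_le_mul_of_nonneg_right (by linarith) hP
      _ ≤ Ur := by rw [hUr]; linarith
      _ ≤ Ur + B := le_add_of_nonneg_right hB0
  have hbudget : 2 * C₄ * s ^ 2 * (Ur + B - A) + C₄ * w * Ur ≤ ((n : ℝ) + 1) / 8 := by
    have hlamle : lam ≤ lambar := lam_le_lambar ha hM hρ hsu hs
    have hwle : w ≤ wbar := w_le_wbar ha hM hρ hsu hs hmthr hmth2
    have hw0 : 0 ≤ w := by rw [hw_def]; positivity
    have hKN' : ((n : ℝ) + 1) / (((2 ^ k) ^ 3 : ℕ) : ℝ) = ρ * s ^ 3 := by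
      rw [← hKN]; push_cast; rfl
    have h := floorBudget_le (lam := lam) (w := w) (N := (n : ℝ) + 1) (K := (((2 ^ k) ^ 3 : ℕ) : ℝ))
      hM ha hC₄ hCu.le hρ hsl hsu hθ0 le_rfl (by positivity) hlamle hw0 hwle (by positivity) hKc
      hKN' ht1 hbud (by push_cast at hN1 ⊢; exact hN1)
    rw [hUr, hB_def, hA_def]
    push_cast at h ⊢
    exact h
  ----------------------------------------------------------------
  -- the deterministic floor inequality
  ----------------------------------------------------------------
  have hw0 : 0 ≤ w := by rw [hw_def]; positivity
  have hUr0 : 0 ≤ Ur := by rw [hUr]; positivity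
  have hA0 : 0 ≤ A := by
    rw [hA_eq]
    have : 0 ≤ 1 - θ := by linarith
    positivity
  have hmain := seven_eighths_le_sum_occupation hs hK hKs hL hv.1 Ψ good Rf yf lb hC₄.le hw0 hUr0
    hA0 hB0 H41 hW hy hloc hE0 hcomb hκ1 hE hUBA hbudget
  push_cast
  exact hmain

end Final
end Literature.MathematicalPhysics.QuantumManyBody.BoseGas

end
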